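import Mathlib
import Literature.Combinatorics.Kakeya.JointsProblem
import Literature.Combinatorics.Kakeya.KakeyaMethodOfMultiplicities
import HarnessLib

/-!
# The joints theorem with the sharp constant (Yu–Zhao 2023, Theorem 1.3, "Joints tightened")

Topic `Literature/Combinatorics/Kakeya`.  Everything in this file is PROVED (no named fact, no
`sorry`).  Companion to `JointsProblem.lean`, which proves the joints theorem of Guth–Katz,
Kaplan–Sharir–Shustin and Quilodrán in Tao's arbitrary-field form `|joints| ≤ n N^{n/(n−1)}`:
here the constant is tightened to the asymptotically optimal one,

H.-H. H. Yu, Y. Zhao, *Joints tightened*, Amer. J. Math. **145** (2023), no. 2, 569–583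
(doi:10.1353/ajm.2023.0014) = arXiv:1911.08605, whose version 2 (18 Dec 2022; numbering of
theorems, lemmas and displays, and the page numbers in the citation tags, are those of
arXiv:1911.08605v2 — the journal pagination was not available) reads, verbatim:

> (§1, p. 1) Given a set of lines, a joint is defined to be a point passed through by `d` lines
> from the set that do not all lie in the same hyperplane. Note that we only count each point at
> most once as a joint, even if more than `d` lines pass through it.
> **Example 1.1.** Take `k` generic hyperplanes (provided that `|𝔽|` is large enough) forming
> `L = C(k, d−1)` lines from `(d−1)`-wise intersections and
> `J = C(k, d) = (((d−1)!)^{1/(d−1)}/d − o(1)) L^{d/(d−1)}` joints from `d`-wise intersections.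
> **Theorem 1.2 (Joints theorem).** For every `d` there is some constant `C_d` so that `L` lines
> in `𝔽^d` form at most `C_d L^{d/(d−1)}` joints.
> **Theorem 1.3 (Main theorem).** The number of joints formed by `L` lines in `𝔽^d` is at most
> `((d−1)!)^{1/(d−1)}/d · L^{d/(d−1)}`.
>
> (§2, p. 2) A joints configuration `(𝓙, 𝓛)` consists of a set `𝓛` of lines in `𝔽^d` and a set
> `𝓙` of joints formed by these lines. We abuse the notation "`p ∈ ℓ`" slightly to deal with the
> cases when some point has more than `d` lines passing through it. At each joint `p`, we pick
> arbitrarily `d` lines from `𝓛` passing through `p` in linearly independent directions, and we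
> write "`p ∈ ℓ`" (and likewise with "`ℓ` contains `p`", etc.) only if `ℓ` is one of these `d`
> chosen lines.
> Given a polynomial `g ∈ 𝔽[x₁, …, x_d]`, a joint `p ∈ 𝓙`, an ordering `ℓ₁, …, ℓ_d` of the `d`
> lines passing through `p`, and a vector `(β₁, …, β_d)` of nonnegative integers, we say that `g`
> vanishes to order `(β₁, …, β_d)` at `p` in directions `(ℓ₁, …, ℓ_d)` if the coefficient of
> `x₁^{ω₁} ⋯ x_d^{ω_d}` in `g(p + x₁ e_{ℓ₁} + ⋯ + x_d e_{ℓ_d})` is zero whenever `0 ≤ ωᵢ < βᵢ` for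
> each `i ∈ [d]`, where `e_{ℓᵢ}` is any nonzero vector parallel to `ℓᵢ`. […] we say that the
> polynomial `g` vanishes to order `β = (β_{p,ℓ})_{(p,ℓ) : p ∈ ℓ} ∈ ℤ^{|𝓙|d}` on `(𝓙, 𝓛)` if, at
> every `p ∈ 𝓙`, `g` vanishes to order `(β_{p,ℓ})_{ℓ ∋ p}` in the directions `(ℓ : ℓ ∋ p)`.
>
> (p. 3) **Lemma 2.1.** Let `(𝓙, 𝓛)` be a joints configuration in `𝔽^d`. Let `n` be a nonnegative
> integer. Let `α_p ∈ ℤ` for each `p ∈ 𝓙` and `β_{p,ℓ} ∈ ℤ_{≥0}` for each `(p, ℓ) ∈ 𝓙 × 𝓛` with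
> `p ∈ ℓ` satisfying (a) `β_{p,ℓ} − α_p ≥ β_{p′,ℓ} − α_{p′}` whenever `p, p′ ∈ ℓ` and
> `β_{p′,ℓ} > 0`, and (b) `∑_{p : p ∈ ℓ} β_{p,ℓ} ≥ n` for every `ℓ ∈ 𝓛`. Then every nonzero
> polynomial that vanishes to order `β = (β_{p,ℓ})_{(p,ℓ) : p ∈ ℓ}` on `(𝓙, 𝓛)` has degree at least
> `n`.
> **Lemma 2.2.** Assuming the same setup as Lemma 2.1, one has
> `∑_{p ∈ 𝓙} ∏_{ℓ ∋ p} β_{p,ℓ} ≥ C(n + d − 1, d)`. (1)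
> (p. 4) **Remark.** One can show that Example 1.1 is the exact optimum under the additional
> hypothesis that every line in `𝓛` contains exactly the same number `n` of joints. Indeed, setting
> `β_{p,ℓ} = 1` for all `(p, ℓ)` and `α_p = 0` for all joints `p` in Lemma 2.2 yields
> `|𝓙| ≥ C(n + d − 1, d) = C(d|𝓙|/|𝓛| + d − 1, d)`; in particular, `C(k, d−1)` lines form at most
> `C(k, d)` joints.
> **Lemma 2.3.** Let `(𝓙, 𝓛)` be a joints configuration in `𝔽^d`. Suppose `a_p ∈ ℝ` for each
> `p ∈ 𝓙` and `b_{p,ℓ} ∈ ℝ_{≥0}` for each `(p, ℓ) ∈ 𝓙 × 𝓛` with `p ∈ ℓ` satisfy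
> (a) `b_{p,ℓ} − a_p = b_{p′,ℓ} − a_{p′}` whenever `p, p′ ∈ ℓ` and `b_{p′,ℓ} > 0`, and
> (b) `∑_{p : p ∈ ℓ} b_{p,ℓ} = 1` for every `ℓ ∈ 𝓛`. Then `∑_{p ∈ 𝓙} ∏_{ℓ ∋ p} b_{p,ℓ} ≥ 1/d!`.
> We say that a joints configuration `(𝓙, 𝓛)` is connected if the graph constructed by taking `𝓙`
> as vertices, with `p, p′ ∈ 𝓙` adjacent if there is some `ℓ ∈ 𝓛` containing both `p` and `p′`,
> is connected.
> **Lemma 2.4.** Let `(𝓙, 𝓛)` be a connected joints configuration in `𝔽^d`. Then there exist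
> real numbers `a_p, b_{p,ℓ}` satisfying the hypothesis of Lemma 2.3 with an additional constraint
> that `∏_{ℓ : ℓ ∋ p} b_{p,ℓ}` has the same value for all `p ∈ 𝓙`.
>
> (p. 5, proof of Theorem 1.3) First suppose that the joints configuration is connected. Choose
> `a_p, b_{p,ℓ}` as in Lemma 2.4. Let `W` denote the common value of `∏_{ℓ : ℓ ∋ p} b_{p,ℓ}`. By
> the AM–GM inequality followed by hypothesis (b) in Lemma 2.3,
> `d J W^{1/d} = ∑_p d (∏_{ℓ ∋ p} b_{p,ℓ})^{1/d} ≤ ∑_p ∑_{ℓ ∋ p} b_{p,ℓ} = ∑_ℓ ∑_{p ∈ ℓ} b_{p,ℓ}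
> = L`; and thus `W ≤ L^d/(d^d J^d)`. Thus, by Lemma 2.3,
> `1/d! ≤ ∑_p ∏_{ℓ ∋ p} b_{p,ℓ} = J W ≤ L^d/(d^d J^{d−1})`. Thus `J ≤ C_d L^{d/(d−1)}` with
> `C_d = ((d−1)!)^{1/(d−1)}/d`. Finally, decompose `(𝓙, 𝓛)` into connected components […] and
> apply the above result individually to each component to obtain
> `|𝓙| = ∑ᵢ |𝓙ᵢ| ≤ C_d ∑ᵢ |𝓛ᵢ|^{d/(d−1)} ≤ C_d |𝓛|^{d/(d−1)}`.

## Setting and definitions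

`F` is any field, the ambient space is `Fin d → F`, lines are `Tao2005UnitSphere.line F x v`
(`= {x + t v}`), joints of a finite family `L` of lines are `Joints.joints L` of
`JointsProblem.lean` (`IsJoint L p`: `d` lines of `L` through `p` with linearly independent
directions — the literal reading "not all in one hyperplane" is `Joints.isJoint_iff` there).
* `JointsConfig F d` — a joints configuration: a finite set `J` of points and at each `p ∈ J` a
  frame `e p` (a matrix whose rows `e p i`, `i : Fin d`, are linearly independent); the chosen
  lines of `p` are `lineAt p i = line F p (e p i)` (pairwise distinct, `lineAt_injective`), `lines`
  is the finite set `𝓛` of all chosen lines, and the incidences "`p ∈ ℓ`" of the paper are the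
  pairs `(p, i)` with `lineAt p i = ℓ` (`onLine ℓ`).  A quantity `β_{p,ℓ}` of the paper, defined
  for `p ∈ ℓ`, is therefore a function `β p i` of the joint and the index of the chosen line.
* `affineSubst M v`, `framePoly p e g = g(p + ∑ᵢ xᵢ eᵢ)` (the paper's `g(p + x₁ e_{ℓ₁} + ⋯)`),
  `VanishesInFrame g p e β` — "`g` vanishes to order `β` at `p` in directions `e`".
* `JointsConfig.IsConnected` — connectedness, as the cut condition (every nonempty proper subset
  of `J` has a joint sharing a chosen line with a joint outside it; for nonempty `J` this is the
  connectedness of the graph of the paper).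
* For the variational problem of Lemma 2.4: `incLine`, `incOn` (incidences on the finite index
  type `↥J × Fin d`), `weightMap` (the linear parametrisation `b_{p,ℓ} = a_p + λ_ℓ` of
  hypothesis (a)), `feasible` (the set `B`), `maxProd` (the objective `max_p ∏_{ℓ ∋ p} b_{p,ℓ}`).
* `momentFlat d T = {x | ∀ t ∈ T, ∑ᵢ xᵢ tⁱ = t^d}`, `exampleLines d A` (Example 1.1).
* `IsMultijoint`, `multijoints` (§3), `JointsConfig.linesAt i` (the `i`-th chosen lines).

## What is proved

* `le_totalDegree_of_vanishesInFrame` — **Lemma 2.1**;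
* `choose_le_sum_prod` — **Lemma 2.2**, and `choose_le_card` — the inequality of the Remark
  (`|𝓙| ≥ C(n + d − 1, d)` when every line carries `≥ n` joints);
* `inv_factorial_le_sum_prod` — **Lemma 2.3** (with `tendsto_choose_div_pow`:
  `C(N + d − 1, d)/N^d → 1/d!`);
* `JointsConfig.exists_weights_prod_eq` — **Lemma 2.4** (via `isCompact_feasible`,
  `feasible_nonempty`, `maxProd_pos`, `exists_fewer_maximisers`);
* `JointsConfig.card_pow_mul_pow_le_of_isConnected` — the connected case of the proof of
  Theorem 1.3 in the form `|𝓙|^{d−1} d^{d−1} ≤ (d−1)! |𝓛|^d`; `JointsConfig.card_le_rpow` —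
  **Theorem 1.3 for configurations**, `|𝓙| ≤ ((d−1)!)^{1/(d−1)}/d · |𝓛|^{d/(d−1)}` (`d ≥ 2`);
* `ncard_joints_le_tight` — **Theorem 1.3 as printed: for every field `F`, every `d ≥ 2` and
  every finite family `L` of lines in `F^d`, `|joints L| ≤ ((d−1)!)^{1/(d−1)}/d · |L|^{d/(d−1)}`**
  (members of `L` that are not lines are never among the `d` lines at a joint, so the statement
  for arbitrary finite `L ⊆ Set (Fin d → F)` is the printed one for sets of lines), and the integer
  form `ncard_joints_pow_mul_pow_le`: `|joints L|^{d−1} d^{d−1} ≤ (d−1)! |L|^d` (compare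
  `Joints.ncard_joints_pow_le` of `JointsProblem.lean`, `|joints L|^{n−1} ≤ n! |L|^n`);
* `JointsConfig.card_le_choose_of_card_onLine_eq` — the "in particular" of the Remark: a
  configuration with `C(k, d−1)` chosen lines each containing exactly `n` joints has at most
  `C(k, d)` joints (`JointsConfig.sum_card_onLine`: `∑_ℓ #{p ∈ ℓ} = d|𝓙|`);
* **Example 1.1, made explicit** (section `Example`): for a finite set `A ⊆ F` of `k` parameters,
  the hyperplanes `∑ᵢ xᵢ tⁱ = t^d`, `t ∈ A` (normals on the moment curve, so that any `d` of them
  are in general position — an instance of the "generic hyperplanes") give the family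
  `exampleLines d A` of their `(d−1)`-wise intersections: at most `C(k, d−1)` members
  (`card_exampleLines_le`), all of them lines when `d ≤ k` (`isLine_of_mem_exampleLines`), with at
  least `C(k, d)` joints (`choose_le_ncard_joints_exampleLines`: the `d`-wise intersections,
  `isJoint_exampleLines`); hence `(k − d + 1)|L| ≤ d |joints L|` for the example
  (`sub_mul_card_exampleLines_le`), while Theorem 1.3 gives `d |joints L| ≤ k |L|` for EVERY
  family of at most `C(k, d−1)` lines (`mul_ncard_joints_le_of_card_le_choose`) — the bound
  "matches, up to a `1 + o(1)` factor, the best known construction";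
* **Theorem 3.2 (multijoints)** (section `Multijoints`): `IsMultijoint L p` / `multijoints L` for
  families `L₀, …, L_{d−1}` (lines `ℓᵢ ∈ Lᵢ` through `p` with independent directions);
  `ncard_multijoints_pow_le` — `|multijoints L|^{d−1} ≤ d! ∏ᵢ |Lᵢ|`, and
  `ncard_multijoints_le_rpow` — `|multijoints L| ≤ (d! |L₁|⋯|L_d|)^{1/(d−1)}` as printed
  (`d ≥ 2`; Zhang's constant `d^{d/(d−1)}` improved to `d!^{1/(d−1)}`); configuration forms
  `JointsConfig.card_pow_le_factorial_mul_prod_of_isConnected`,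
  `JointsConfig.card_le_rpow_prod_linesAt` (`linesAt i` = the `i`-th chosen lines).

## Proof architecture, and the deviations

The printed proofs are followed, with these remarks.
1. **`𝓙 ≠ ∅` is added to Lemmas 2.1–2.3.** For the empty configuration the three printed
   statements fail when `n, d ≥ 1` (a nonzero constant vanishes to any order on it; both sides of
   (b) are vacuous); the paper uses them only for nonempty configurations.
2. Lemma 2.1: the minimal counterexample `(p, γ)` (least `γ₁ + ⋯ + γ_d − α_p`, by
   `Int.exists_least_of_bdd`) is handled as in arXiv v2: minimality gives, at every joint `p′` of
   the line `ℓ₁ = ℓ_{p,i}` with `β′ = β_{p′,ℓ₁} > 0` (or `p′ = p`), vanishing of *all* coefficients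
   of `g(p′ + ∑ xⱼ e′ⱼ)` of total degree `< β′ + ∑_{j ≠ i}(γⱼ − 1)` — i.e. `g` vanishes to that
   total order at `p′` (`FiniteFieldKakeya.VanishesToOrder`), a frame-independent statement
   (`vanishesToOrder_iff_framePoly`: "since `e_{ℓ₁}, e_{ℓ′₂}, …` form a basis, the same statement
   also holds when `e_{ℓ′ⱼ}` are replaced with `e_{ℓⱼ}`"); in `p`'s frame this is vanishing of
   `h = g(p + ∑ xⱼ eⱼ)` at `c δᵢ` (`p′ = p + c eᵢ`), and the slice `g_{γ₂−1,…,γ_d−1}(x₁)` of the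
   paper is realised as the restriction to the `i`-th axis of the Hasse derivative `∂^{θ₀} h`,
   `θ₀ = (γⱼ − 1)_{j ≠ i}` (`coeff_aeval_axisSubst`, `FiniteFieldKakeya.coeff_hasseDeriv`), which is
   divisible by `(x − c)^{β′}` (`FiniteFieldKakeya.X_sub_C_pow_dvd_aeval_line`); the factors for
   the distinct joints of `ℓ₁` are coprime, so `deg g ≥ deg h ≥ deg(slice) + |θ₀| ≥ ∑ β ≥ n`.
3. Lemma 2.2: the linear constraints are the coefficient functionals
   `g ↦ [x^ω] g(p + ∑ xᵢ eᵢ)`, `ω < β_p`, on the space of polynomials of degree `≤ n − 1`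
   (dimension `≥ C(n − 1 + d, d)`, `FiniteFieldKakeya.choose_le_finrank_restrictTotalDegree`),
   as in `Furstenberg.exists_mem_vanishesToOrder_of_sum_choose_lt`.
4. Lemma 2.3: (a) and (b) give `b_{p,ℓ} = a_p + λ_ℓ` for *all* `p ∈ ℓ` (some `b_{p′,ℓ} > 0` on
   every line); the integers are `α_p = ⌈a_p N⌉`, `β_{p,ℓ} = max(0, α_p + ⌈λ_ℓ N⌉ + 1)`, so that
   `b N ≤ β ≤ b N + 3`, and `N → ∞` is `le_of_tendsto_of_tendsto`.
5. Lemma 2.4: `B` is `[0,1]`-valued weights (automatic from (b) and nonnegativity) that sum to `1`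
   on each line and lie in the range of `weightMap` (a finite-dimensional, hence closed, subspace);
   minimisers exist by compactness (`IsCompact.exists_isMinOn`), the secondary minimisation of the
   number of maximising joints is `Nat.find`.  That `b_{p,ℓ} > 0` at a maximising joint is taken
   from `W > 0`, which follows from Lemma 2.3 (arXiv v2 argues instead that otherwise all joints
   are maximising); the modification "decrease `b_{p,ℓ}` at each maximising `p ∈ ℓ` and increase
   at each non-maximising `p ∈ ℓ`, unchanged on lines with all or no maximising joints" is the
   explicit one `a_p ↦ a_p − ε[p maximising]`, `λ_ℓ ↦ λ_ℓ + ε k_ℓ/N_ℓ` (`k_ℓ` of the `N_ℓ`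
   joints of `ℓ` maximising), for `ε > 0` small (`exists_fewer_maximisers`).
6. Theorem 1.3: the decomposition into connected components is an induction on `|𝓙|`: a
   disconnected configuration splits along a cut into two sub-configurations with disjoint sets of
   chosen lines, and `x ↦ x^{d/(d−1)}` is superadditive (`Real.add_rpow_le_rpow_add`).  For a
   family `L` of lines, a configuration is obtained by choosing the `d` lines at each joint
   (`joints_finite` of `JointsProblem.lean` for finiteness), and its chosen lines form a subset of
   `L`.

7. Example 1.1 is formalized for the explicit choice of hyperplanes with normals
   `(1, t, …, t^{d−1})` and constants `t^d` (Vandermonde systems, `Matrix.vandermonde`): a point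
   lies on at most `d` of them because `X^d − ∑ pᵢ Xⁱ` has at most `d` roots, so distinct
   `d`-sets of parameters give distinct joints; "generic hyperplanes" in general, and the count
   `J = C(k, d)` as an equality (only `≥` is proved, and `|L| ≤ C(k, d−1)`), are not formalized.

8. Theorem 3.2: the weighted AM–GM `d (∏ᵢ b_{p,i}/Lᵢ)^{1/d} ≤ ∑ᵢ b_{p,i}/Lᵢ` with
   `Lᵢ = |linesAt i|` and `∑_p b_{p,i} ≤ Lᵢ` (`sum_le_card_linesAt`; the paper's "`= d`" is
   "`≤ d`" when some line carries no full set of incidences); the reduction to connected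
   configurations uses the superadditivity `(∏ aᵢ)^{1/(d−1)} + (∏ bᵢ)^{1/(d−1)} ≤
   (∏ (aᵢ + bᵢ))^{1/(d−1)}` (private `prod_rpow_add_prod_rpow_le`, by AM–GM), which the paper
   leaves implicit ("As before, we can reduce to case of a connected configuration").

## Not in this file

Theorem 1.2 is `Joints.ncard_joints_le` of `JointsProblem.lean`; Guth's conjecture itself (the
exact optimum `C(k, d)` without the equal-count hypothesis) is open; Theorem 3.1 with an
unspecified constant is implied by Theorem 3.2 and not stated separately; Conjecture 3.3 and the
rainbow-triangle discussion of §3; §4 (joints of flats, Theorem 4.2, Lemmas 4.3–4.5; joints of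
varieties).

## References

* [YuZhao2023JointsTightened] H.-H. H. Yu, Y. Zhao, Amer. J. Math. 145 (2023) 569–583,
  arXiv:1911.08605v2 — §1 p. 1 (Example 1.1, Theorems 1.2–1.3), §2 pp. 2–5 (definitions,
  Lemmas 2.1–2.4 with proofs, Remark, proof of Theorem 1.3), §3 pp. 5–6 (multijoints,
  Theorems 3.1–3.2 with proof).
* [Tao2014PolynomialMethodSurvey] — the joints theorem as formalized in `JointsProblem.lean`.
* [DvirEtAl2013], [SarafSudan2008KakeyaFiniteFields] — multiplicities, Hasse derivatives and the
  shift `g(x + a)` (`FiniteFieldKakeya.VanishesToOrder`, `shift`, `mult`, files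
  `KakeyaMultiplicityBound.lean`, `KakeyaMethodOfMultiplicities.lean`).
-/

namespace Literature.Combinatorics.Kakeya

namespace Joints

open MvPolynomial Finset Module Tao2005UnitSphere FiniteFieldKakeya
open Literature.AlgebraicGeometry.Resolution (hasseDeriv)

variable {F : Type*} [Field F] {d : ℕ}

/-! ### Affine substitutions `x ↦ v + x M` -/
section AffineSubst

/-- The affine substitution `x ↦ v + x M` (row-vector convention) as a tuple of degree-one
polynomials: coordinate `j` of the image point is `v_j + ∑_i x_i M_{ij}`. [folklore] -/
noncomputable def affineSubst (M : Matrix (Fin d) (Fin d) F) (v : Fin d → F) :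
    Fin d → MvPolynomial (Fin d) F :=
  fun j => C (v j) + ∑ i, C (M i j) * X i

/-- Unfolding `affineSubst`. [folklore] -/
private theorem affineSubst_apply (M : Matrix (Fin d) (Fin d) F) (v : Fin d → F) (j : Fin d) :
    affineSubst M v j = C (v j) + ∑ i, C (M i j) * X i :=
  rfl

/-- The substitution `x ↦ v + x` is the shift. [folklore] -/
private theorem affineSubst_one (v : Fin d → F) : affineSubst 1 v = fun i => X i + C (v i) := by
  funext j
  rw [affineSubst_apply, Finset.sum_eq_single j]
  · rw [Matrix.one_apply_eq, C_1, one_mul, add_comm]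
  · intro i _ hij
    rw [Matrix.one_apply_ne hij, C_0, zero_mul]
  · intro h
    exact absurd (mem_univ j) h

/-- `shift v g = g(x + v)` is the substitution by `affineSubst 1 v`. [folklore] -/
private theorem shift_eq_aeval_affineSubst (v : Fin d → F) (g : MvPolynomial (Fin d) F) :
    shift v g = aeval (affineSubst 1 v) g := by
  rw [shift_eq, affineSubst_one]

/-- **Composition of affine substitutions:** substituting `x ↦ v + x M` into `g(w + y N)` gives
`g((w + v N) + x (M N))`. [folklore] -/
private theorem aeval_affineSubst_aeval (M N : Matrix (Fin d) (Fin d) F) (v w : Fin d → F)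
    (g : MvPolynomial (Fin d) F) :
    aeval (affineSubst M v) (aeval (affineSubst N w) g) =
      aeval (affineSubst (M * N) (w + Matrix.vecMul v N)) g := by
  rw [← AlgHom.comp_apply, comp_aeval]
  suffices hfun : (fun i => aeval (affineSubst M v) (affineSubst N w i)) =
      affineSubst (M * N) (w + Matrix.vecMul v N) by rw [hfun]
  funext j
  simp only [affineSubst_apply, map_add, map_sum, map_mul, aeval_C, aeval_X, algebraMap_eq,
    Pi.add_apply, Matrix.vecMul, dotProduct, Matrix.mul_apply]
  have h1 : ∀ i : Fin d, C (N i j) * (C (v i) + ∑ k, C (M k i) * (X k : MvPolynomial (Fin d) F)) =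
      C (v i) * C (N i j) + ∑ k, C (M k i) * C (N i j) * X k := by
    intro i
    rw [mul_add, Finset.mul_sum]
    congr 1
    · ring
    · exact Finset.sum_congr rfl fun k _ => by ring
  simp_rw [h1]
  rw [Finset.sum_add_distrib, ← add_assoc]
  congr 1
  rw [Finset.sum_comm]
  exact Finset.sum_congr rfl fun k _ => by rw [Finset.sum_mul]

/-- The zero substitution matrix with zero translation, composed: `x ↦ 0 + x M`, then shift by
nothing — a bookkeeping special case: `w + 0 N = w`. [folklore] -/
private theorem aeval_affineSubst_zero_aeval (M N : Matrix (Fin d) (Fin d) F) (w : Fin d → F)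
    (g : MvPolynomial (Fin d) F) :
    aeval (affineSubst M 0) (aeval (affineSubst N w) g) = aeval (affineSubst (M * N) w) g := by
  rw [aeval_affineSubst_aeval, Matrix.zero_vecMul, add_zero]

/-- A linear form `∑_i c_i x_i` is homogeneous of degree `1`. [folklore] -/
private theorem isHomogeneous_linearForm (c : Fin d → F) :
    (∑ i, C (c i) * (X i : MvPolynomial (Fin d) F)).IsHomogeneous 1 := by
  refine IsHomogeneous.sum _ _ _ fun i _ => ?_
  simpa using (isHomogeneous_X F i).C_mul (c i)

/-- **A linear substitution does not lower the order of vanishing at the origin:** if every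
monomial of `h` has degree `≥ m`, so does every monomial of `h(x M)`. [folklore] -/
private theorem le_degree_of_mem_support_aeval_affineSubst_zero (M : Matrix (Fin d) (Fin d) F)
    {h : MvPolynomial (Fin d) F} {m : ℕ} (hm : ∀ s ∈ h.support, m ≤ s.degree)
    {s : Fin d →₀ ℕ} (hs : s ∈ (aeval (affineSubst M 0) h).support) : m ≤ s.degree := by
  classical
  -- write `h` as a sum of its monomials and substitute termwise
  have hsum : aeval (affineSubst M 0) h =
      ∑ t ∈ h.support, C (coeff t h) * ∏ j, (∑ i, C (M i j) * X i) ^ (t j) := by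
    conv_lhs => rw [h.as_sum]
    rw [map_sum]
    refine Finset.sum_congr rfl fun t _ => ?_
    rw [aeval_monomial, algebraMap_eq, Finsupp.prod_fintype _ _ fun j => pow_zero _]
    refine congrArg (C (coeff t h) * ·) (Finset.prod_congr rfl fun j _ => ?_)
    rw [affineSubst_apply, Pi.zero_apply, C_0, zero_add]
  -- each term is homogeneous of degree `|t| ≥ m`
  have hhom : ∀ t ∈ h.support,
      (C (coeff t h) * ∏ j, (∑ i, C (M i j) * (X i : MvPolynomial (Fin d) F)) ^ (t j)).IsHomogeneous
        (t.degree) := by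
    intro t _
    have hprod := IsHomogeneous.prod (univ : Finset (Fin d))
      (fun j => (∑ i, C (M i j) * (X i : MvPolynomial (Fin d) F)) ^ (t j)) (fun j => t j)
      fun j _ => by simpa using (isHomogeneous_linearForm (fun i => M i j)).pow (t j)
    have hdeg : ∑ j ∈ (univ : Finset (Fin d)), t j = t.degree := (Finsupp.degree_eq_sum t).symm
    rw [hdeg] at hprod
    simpa using (isHomogeneous_C (Fin d) (coeff t h)).mul hprod
  rw [hsum] at hs
  obtain ⟨t, ht, hst⟩ := Finset.mem_biUnion.1 (MvPolynomial.support_sum hs)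
  have hne : coeff s (C (coeff t h) *
      ∏ j, (∑ i, C (M i j) * (X i : MvPolynomial (Fin d) F)) ^ (t j)) ≠ 0 := mem_support_iff.1 hst
  have := hhom t ht hne
  have h1 : s.degree = Finsupp.weight 1 s := by
    rw [Finsupp.degree_eq_weight_one]
    rfl
  rw [h1, this]
  exact hm t ht

/-- An affine substitution does not raise the total degree. [folklore] -/
private theorem totalDegree_aeval_affineSubst_le (M : Matrix (Fin d) (Fin d) F) (v : Fin d → F)
    (g : MvPolynomial (Fin d) F) :
    (aeval (affineSubst M v) g).totalDegree ≤ g.totalDegree := by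
  classical
  conv_lhs => rw [g.as_sum]
  rw [map_sum]
  refine totalDegree_finsetSum_le fun t ht => ?_
  rw [aeval_monomial, algebraMap_eq, Finsupp.prod_fintype _ _ fun j => pow_zero _]
  refine (totalDegree_mul _ _).trans ?_
  rw [totalDegree_C, zero_add]
  refine (totalDegree_finsetProd _ _).trans ?_
  have hdeg1 : ∀ j, (affineSubst M v j).totalDegree ≤ 1 := by
    intro j
    rw [affineSubst_apply]
    refine (totalDegree_add _ _).trans (max_le ?_ ?_)
    · rw [totalDegree_C]; exact Nat.zero_le _
    · refine totalDegree_finsetSum_le fun i _ => (totalDegree_mul _ _).trans ?_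
      rw [totalDegree_C, totalDegree_X, zero_add]
  calc ∑ j, ((affineSubst M v j) ^ (t j)).totalDegree ≤ ∑ j, t j := by
        refine Finset.sum_le_sum fun j _ => (totalDegree_pow _ _).trans ?_
        calc t j * (affineSubst M v j).totalDegree ≤ t j * 1 :=
              Nat.mul_le_mul_left _ (hdeg1 j)
          _ = t j := mul_one _
    _ = t.sum fun _ e => e := by
        rw [Finsupp.sum_fintype _ _ fun _ => rfl]
    _ ≤ g.totalDegree := le_totalDegree ht

end AffineSubst

/-! ### Frame polynomials `g(p + x₁ e₁ + ⋯ + x_d e_d)` and vanishing to order `β` in a frame -/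
section Frame

/-- **The polynomial `g` in the affine frame `(p; e₁, …, e_d)`:**
`framePoly p e g = g(p + x₁ e₁ + ⋯ + x_d e_d)`, the frame being the matrix `e` with rows
`e₁, …, e_d` (Yu–Zhao: "`g(p + x₁ e_{ℓ₁} + ⋯ + x_d e_{ℓ_d})`").
[cite: YuZhao2023JointsTightened, §2 (arXiv v2, p. 2: vanishing to order)] -/
noncomputable def framePoly (p : Fin d → F) (e : Matrix (Fin d) (Fin d) F)
    (g : MvPolynomial (Fin d) F) : MvPolynomial (Fin d) F :=
  aeval (affineSubst e p) g

/-- Unfolding `framePoly`. [folklore] -/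
private theorem framePoly_eq (p : Fin d → F) (e : Matrix (Fin d) (Fin d) F) (g : MvPolynomial
    (Fin d) F) :
    framePoly p e g = aeval (affineSubst e p) g :=
  rfl

/-- **`g` vanishes to order `(β₁, …, β_d)` at `p` in directions `(e₁, …, e_d)`** (Yu–Zhao, §2):
"the coefficient of `x₁^{ω₁} ⋯ x_d^{ω_d}` in `g(p + x₁ e_{ℓ₁} + ⋯ + x_d e_{ℓ_d})` is zero whenever
`0 ≤ ωᵢ < βᵢ` for each `i ∈ [d]`". [cite: YuZhao2023JointsTightened, §2 (arXiv v2, p. 2)] -/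
def VanishesInFrame (g : MvPolynomial (Fin d) F) (p : Fin d → F) (e : Matrix (Fin d) (Fin d) F)
    (β : Fin d → ℕ) : Prop :=
  ∀ ω : Fin d →₀ ℕ, (∀ i, ω i < β i) → coeff ω (framePoly p e g) = 0

/-- Unfolding `VanishesInFrame`.
[cite: YuZhao2023JointsTightened, §2 (arXiv v2, p. 2: vanishing to order)] -/
theorem vanishesInFrame_iff (g : MvPolynomial (Fin d) F) (p : Fin d → F)
    (e : Matrix (Fin d) (Fin d) F) (β : Fin d → ℕ) :
    VanishesInFrame g p e β ↔
      ∀ ω : Fin d →₀ ℕ, (∀ i, ω i < β i) → coeff ω (framePoly p e g) = 0 :=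
  Iff.rfl

/-- Vanishing to order `β` implies vanishing to every smaller order (immediate from the
definition). [cite: YuZhao2023JointsTightened, §2 (arXiv v2, p. 2: vanishing to order)] -/
theorem VanishesInFrame.mono {g : MvPolynomial (Fin d) F} {p : Fin d → F}
    {e : Matrix (Fin d) (Fin d) F} {β γ : Fin d → ℕ} (h : VanishesInFrame g p e β)
    (hle : ∀ i, γ i ≤ β i) : VanishesInFrame g p e γ :=
  fun ω hω => h ω fun i => (hω i).trans_le (hle i)

/-- The frame polynomial in the standard frame is the shift `g(x + p)`. [folklore] -/
private theorem framePoly_one (p : Fin d → F) (g : MvPolynomial (Fin d) F) :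
    framePoly p 1 g = shift p g := by
  rw [framePoly_eq, shift_eq_aeval_affineSubst]

/-- Moving the base point along a frame direction is a shift of the frame polynomial:
`g((p + c eᵢ) + ∑ x_j e_j) = (framePoly p e g)(x + c δᵢ)`. [folklore] -/
private theorem framePoly_add_smul (p : Fin d → F) (e : Matrix (Fin d) (Fin d) F) (i : Fin d)
    (c : F)
    (g : MvPolynomial (Fin d) F) :
    framePoly (p + c • e i) e g = shift (Pi.single i c) (framePoly p e g) := by
  rw [framePoly_eq, framePoly_eq, shift_eq_aeval_affineSubst, aeval_affineSubst_aeval, one_mul,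
    Matrix.single_vecMul]
  rfl

/-- Changing the frame at a fixed base point is a linear substitution:
`framePoly p e g = (shift p g)(x e)`. [folklore] -/
private theorem framePoly_eq_aeval_shift (p : Fin d → F) (e : Matrix (Fin d) (Fin d) F)
    (g : MvPolynomial (Fin d) F) :
    framePoly p e g = aeval (affineSubst e 0) (shift p g) := by
  rw [framePoly_eq, shift_eq_aeval_affineSubst, aeval_affineSubst_zero_aeval, mul_one]

/-- … and conversely `shift p g = (framePoly p e g)(x e⁻¹)` for an invertible frame. [folklore] -/
private theorem shift_eq_aeval_framePoly (p : Fin d → F) {e : Matrix (Fin d) (Fin d) F}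
    (he : IsUnit e.det)
    (g : MvPolynomial (Fin d) F) :
    shift p g = aeval (affineSubst e⁻¹ 0) (framePoly p e g) := by
  rw [framePoly_eq, aeval_affineSubst_zero_aeval, Matrix.nonsing_inv_mul _ he,
    shift_eq_aeval_affineSubst]

/-- The frame polynomial of a nonzero polynomial in an invertible frame is nonzero. [folklore] -/
private theorem framePoly_ne_zero {g : MvPolynomial (Fin d) F} (hg : g ≠ 0) (p : Fin d → F)
    {e : Matrix (Fin d) (Fin d) F} (he : IsUnit e.det) : framePoly p e g ≠ 0 := by
  intro h
  have := shift_eq_aeval_framePoly p he g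
  rw [h, map_zero] at this
  exact shift_ne_zero hg p this

/-- The frame polynomial has total degree at most that of `g`. [folklore] -/
private theorem totalDegree_framePoly_le (p : Fin d → F) (e : Matrix (Fin d) (Fin d) F)
    (g : MvPolynomial (Fin d) F) : (framePoly p e g).totalDegree ≤ g.totalDegree :=
  totalDegree_aeval_affineSubst_le e p g

/-- **The order of vanishing at a point does not depend on the frame:** `g` vanishes to order `m`
at `p` (all Hasse derivatives of order `< m` vanish, `VanishesToOrder`) iff every monomial of the
frame polynomial `g(p + ∑ xᵢ eᵢ)` has degree `≥ m`, for any invertible frame `e`.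
[cite: YuZhao2023JointsTightened, Lemma 2.1 (proof; arXiv v2, p. 3: "since `e_ℓ₁, e_ℓ′₂, …, e_ℓ′_d`
form a basis, the same statement also holds …")] -/
theorem vanishesToOrder_iff_framePoly (g : MvPolynomial (Fin d) F) (p : Fin d → F)
    {e : Matrix (Fin d) (Fin d) F} (he : IsUnit e.det) (m : ℕ) :
    VanishesToOrder g p m ↔ ∀ s ∈ (framePoly p e g).support, m ≤ s.degree := by
  constructor
  · intro h s hs
    rw [framePoly_eq_aeval_shift] at hs
    exact le_degree_of_mem_support_aeval_affineSubst_zero e h hs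
  · intro h s hs
    rw [shift_eq_aeval_framePoly p he] at hs
    exact le_degree_of_mem_support_aeval_affineSubst_zero e⁻¹ h hs

/-- A frame given by linearly independent vectors is an invertible matrix. [folklore] -/
private theorem isUnit_det_of_linearIndependent {e : Matrix (Fin d) (Fin d) F}
    (he : LinearIndependent F (fun i => e i)) : IsUnit e.det := by
  classical
  rw [← Matrix.isUnit_iff_isUnit_det]
  exact Matrix.linearIndependent_rows_iff_isUnit.1 he

end Frame

/-! ### Restriction to a coordinate axis -/
section Axis

/-- The substitution restricting a polynomial to the `i`-th coordinate axis `t ↦ t δᵢ`, in the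
form used by `FiniteFieldKakeya.X_sub_C_pow_dvd_aeval_line` (the line `0 + t δᵢ`). [folklore] -/
noncomputable def axisSubst (i : Fin d) : Fin d → Polynomial F :=
  fun j => Polynomial.C ((0 : Fin d → F) j) +
    Polynomial.C ((Pi.single i 1 : Fin d → F) j) * Polynomial.X

/-- `axisSubst i i = X` and `axisSubst i j = 0` for `j ≠ i`. [folklore] -/
private theorem axisSubst_apply (i j : Fin d) :
    axisSubst (F := F) i j = if j = i then Polynomial.X else 0 := by
  unfold axisSubst
  by_cases h : j = i
  · subst h; simp
  · simp [h]

/-- **Coefficients of the restriction to a coordinate axis:** the coefficient of `t^k` in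
`H(t δᵢ)` is the coefficient of `xᵢ^k` in `H`. [folklore] -/
private theorem coeff_aeval_axisSubst (i : Fin d) (H : MvPolynomial (Fin d) F) (k : ℕ) :
    (aeval (axisSubst i) H).coeff k = coeff (Finsupp.single i k) H := by
  classical
  -- the value of the substitution on a monomial
  have hmon : ∀ (s : Fin d →₀ ℕ) (a : F), aeval (axisSubst (F := F) i) (monomial s a) =
      if (∀ j, j ≠ i → s j = 0) then Polynomial.C a * Polynomial.X ^ (s i) else 0 := by
    intro s a
    rw [aeval_monomial, Polynomial.algebraMap_eq, Finsupp.prod_fintype _ _ fun j => pow_zero _,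
      ← Finset.mul_prod_erase univ _ (mem_univ i), axisSubst_apply, if_pos rfl]
    have hrest : ∏ j ∈ univ.erase i, (axisSubst (F := F) i j) ^ (s j) =
        if (∀ j, j ≠ i → s j = 0) then 1 else 0 := by
      split_ifs with hs
      · refine Finset.prod_eq_one fun j hj => ?_
        rw [hs j (Finset.ne_of_mem_erase hj), pow_zero]
      · push Not at hs
        obtain ⟨j, hji, hsj⟩ := hs
        refine Finset.prod_eq_zero (Finset.mem_erase.2 ⟨hji, mem_univ j⟩) ?_
        rw [axisSubst_apply, if_neg hji, zero_pow hsj]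
    rw [hrest]
    split_ifs <;> simp
  conv_lhs => rw [H.as_sum, map_sum]
  rw [Polynomial.finsetSum_coeff]
  have hterm : ∀ s ∈ H.support, (aeval (axisSubst (F := F) i) (monomial s (coeff s H))).coeff k =
      if s = Finsupp.single i k then coeff s H else 0 := by
    intro s _
    rw [hmon]
    by_cases hs : s = Finsupp.single i k
    · subst hs
      rw [if_pos (fun j hj => by simp [Ne.symm hj]), if_pos rfl,
        Polynomial.coeff_C_mul, Polynomial.coeff_X_pow, Finsupp.single_eq_same, if_pos rfl, mul_one]
    · rw [if_neg hs]
      split_ifs with hj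
      · rw [Polynomial.coeff_C_mul, Polynomial.coeff_X_pow]
        have hki : k ≠ s i := by
          intro hk
          apply hs
          ext j
          by_cases hji : j = i
          · subst hji; rw [Finsupp.single_eq_same, hk]
          · rw [hj j hji, Finsupp.single_apply, if_neg (Ne.symm hji)]
        rw [if_neg hki, mul_zero]
      · rw [Polynomial.coeff_zero]
  rw [Finset.sum_congr rfl hterm, Finset.sum_ite_eq']
  split_ifs with hmem
  · rfl
  · exact (notMem_support_iff.1 hmem).symm

/-- The multi-index binomial `C(δᵢ k + θ, θ) = 1` when `θᵢ = 0`. [folklore] -/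
private theorem mchoose_single_add {i : Fin d} {θ : Fin d →₀ ℕ} (hθ : θ i = 0) (k : ℕ) :
    mchoose (Finsupp.single i k + θ) θ = 1 := by
  unfold mchoose
  refine Finset.prod_eq_one fun j _ => ?_
  by_cases hji : j = i
  · subst hji
    rw [hθ, Nat.choose_zero_right]
  · rw [Finsupp.add_apply, Finsupp.single_apply, if_neg (Ne.symm hji), zero_add, Nat.choose_self]

end Axis

/-! ### Joints configurations (Yu–Zhao §2) -/
section Config

variable (F d) in
/-- **A joints configuration** (Yu–Zhao, §2: "a set `𝓛` of lines in `𝔽^d` and a set `𝓙` of joints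
formed by these lines … At each joint `p`, pick arbitrarily `d` lines from `𝓛` passing through `p`
in linearly independent directions, and we write '`p ∈ ℓ`' only if `ℓ` is one of these `d` chosen
lines"): a finite set `J` of points and, at each point `p ∈ J`, a frame `e p` — a matrix whose
`d` rows `e p 0, …, e p (d−1)` are linearly independent direction vectors; the chosen lines of `p`
are `ℓ_{p,i} = {p + t · e p i}` (`lineAt`).  The frames at points outside `J` are never used.
[cite: YuZhao2023JointsTightened, §2 (arXiv v2, p. 2: joints configuration)] -/
structure JointsConfig where
  /-- the joints -/
  J : Finset (Fin d → F)
  /-- the frame of chosen directions at each point -/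
  e : (Fin d → F) → Matrix (Fin d) (Fin d) F
  /-- at a joint the `d` chosen directions are linearly independent -/
  linearIndependent : ∀ p ∈ J, LinearIndependent F (fun i => e p i)

namespace JointsConfig

variable (cfg : JointsConfig F d)

/-- The `i`-th chosen line `ℓ_{p,i} = {p + t eᵢ(p) : t ∈ F}` through `p`. [folklore] -/
def lineAt (p : Fin d → F) (i : Fin d) : Set (Fin d → F) :=
  line F p (cfg.e p i)

open scoped Classical in
/-- The set `𝓛` of chosen lines of the configuration.
[cite: YuZhao2023JointsTightened, §2 (arXiv v2, p. 2)] -/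
noncomputable def lines : Finset (Set (Fin d → F)) :=
  cfg.J.biUnion fun p => univ.image fun i => cfg.lineAt p i

open scoped Classical in
/-- The incidences "`p ∈ ℓ`" of the paper supported on the line `ℓ`: the pairs `(p, i)` with
`p ∈ J` whose `i`-th chosen line is `ℓ`. [cite: YuZhao2023JointsTightened, §2 (arXiv v2, p. 2)] -/
noncomputable def onLine (ℓ : Set (Fin d → F)) : Finset ((Fin d → F) × Fin d) :=
  (cfg.J ×ˢ univ).filter fun q => cfg.lineAt q.1 q.2 = ℓ

/-- Unfolding `lineAt`. [cite: YuZhao2023JointsTightened, §2 (arXiv v2, p. 2)] -/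
theorem lineAt_eq (p : Fin d → F) (i : Fin d) : cfg.lineAt p i = line F p (cfg.e p i) := rfl

/-- Membership in `lines`. [cite: YuZhao2023JointsTightened, §2 (arXiv v2, p. 2)] -/
theorem mem_lines_iff {ℓ : Set (Fin d → F)} :
    ℓ ∈ cfg.lines ↔ ∃ p ∈ cfg.J, ∃ i, cfg.lineAt p i = ℓ := by
  unfold lines
  simp only [Finset.mem_biUnion, Finset.mem_image, mem_univ, true_and]

/-- Membership in `onLine`.
[cite: YuZhao2023JointsTightened, §2 (arXiv v2, p. 2: "we write `p ∈ ℓ` … only if `ℓ` is one of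
these `d` chosen lines")] -/
theorem mem_onLine_iff {ℓ : Set (Fin d → F)} {q : (Fin d → F) × Fin d} :
    q ∈ cfg.onLine ℓ ↔ q.1 ∈ cfg.J ∧ cfg.lineAt q.1 q.2 = ℓ := by
  unfold onLine
  simp only [Finset.mem_filter, Finset.mem_product, mem_univ, and_true]

/-- A chosen line is a line of the configuration.
[cite: YuZhao2023JointsTightened, §2 (arXiv v2, p. 2)] -/
theorem lineAt_mem_lines {p : Fin d → F} (hp : p ∈ cfg.J) (i : Fin d) :
    cfg.lineAt p i ∈ cfg.lines :=
  cfg.mem_lines_iff.2 ⟨p, hp, i, rfl⟩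

/-- `(p, i)` is an incidence of its own line.
[cite: YuZhao2023JointsTightened, §2 (arXiv v2, p. 2)] -/
theorem mem_onLine_self {p : Fin d → F} (hp : p ∈ cfg.J) (i : Fin d) :
    (p, i) ∈ cfg.onLine (cfg.lineAt p i) :=
  cfg.mem_onLine_iff.2 ⟨hp, rfl⟩

/-- The frame at a joint is an invertible matrix. [folklore] -/
private theorem isUnit_det {p : Fin d → F} (hp : p ∈ cfg.J) : IsUnit (cfg.e p).det :=
  isUnit_det_of_linearIndependent (cfg.linearIndependent p hp)

/-- A chosen direction at a joint is nonzero. [folklore] -/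
private theorem e_ne_zero {p : Fin d → F} (hp : p ∈ cfg.J) (i : Fin d) : cfg.e p i ≠ 0 :=
  (cfg.linearIndependent p hp).ne_zero i

/-- **The `d` chosen lines through a joint are distinct.**
[cite: YuZhao2023JointsTightened, Lemma 2.1 (proof; arXiv v2, p. 3: "the `d` distinct lines of `𝓛`
passing through `p`")] -/
theorem lineAt_injective {p : Fin d → F} (hp : p ∈ cfg.J) : Function.Injective (cfg.lineAt p) := by
  intro i j hij
  by_contra hne
  obtain ⟨c, -, hc⟩ := exists_eq_smul_of_line_eq (cfg.e_ne_zero hp j) hij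
  -- `e p j = c • e p i` contradicts linear independence
  have hv := cfg.linearIndependent p hp
  have hsum : ∑ k ∈ ({i, j} : Finset (Fin d)),
      (fun k => if k = j then (-1 : F) else c) k • cfg.e p k = 0 := by
    rw [Finset.sum_pair hne]
    simp [hne, hc]
  have := linearIndependent_iff'.1 hv {i, j} _ hsum j (by simp)
  simp at this

/-- A point incident to the chosen line `ℓ_{p,i}` is `p + c eᵢ(p)` for some scalar `c`.
[folklore] -/
private theorem exists_eq_add_smul_of_mem_onLine {p : Fin d → F} {i : Fin d} {q :
    (Fin d → F) × Fin d}
    (hq : q ∈ cfg.onLine (cfg.lineAt p i)) : ∃ c : F, p + c • cfg.e p i = q.1 := by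
  obtain ⟨-, hline⟩ := cfg.mem_onLine_iff.1 hq
  have hmem : q.1 ∈ cfg.lineAt q.1 q.2 := mem_line_self _ _
  rw [hline] at hmem
  exact mem_line_iff.1 hmem

/-- Two incidences of the same line with the same point are equal. [folklore] -/
private theorem eq_of_mem_onLine_of_fst_eq {ℓ : Set (Fin d → F)} {q q' : (Fin d → F) × Fin d}
    (hq : q ∈ cfg.onLine ℓ) (hq' : q' ∈ cfg.onLine ℓ) (h : q.1 = q'.1) : q = q' := by
  obtain ⟨hqJ, hqℓ⟩ := cfg.mem_onLine_iff.1 hq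
  obtain ⟨-, hq'ℓ⟩ := cfg.mem_onLine_iff.1 hq'
  refine Prod.ext h (cfg.lineAt_injective hqJ ?_)
  rw [hqℓ, ← hq'ℓ, h]

end JointsConfig

end Config

/-! ### Lemma 2.1: the vanishing lemma -/
section Vanishing

/-- **Lemma 2.1 (Yu–Zhao).** "Let `(𝓙, 𝓛)` be a joints configuration in `𝔽^d`. Let `n` be a
nonnegative integer. Let `α_p ∈ ℤ` for each `p ∈ 𝓙` and `β_{p,ℓ} ∈ ℤ_{≥0}` for each
`(p, ℓ) ∈ 𝓙 × 𝓛` with `p ∈ ℓ` satisfying (a) `β_{p,ℓ} − α_p ≥ β_{p′,ℓ} − α_{p′}` whenever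
`p, p′ ∈ ℓ` and `β_{p′,ℓ} > 0`, and (b) `∑_{p : p ∈ ℓ} β_{p,ℓ} ≥ n` for every `ℓ ∈ 𝓛`. Then every
nonzero polynomial that vanishes to order `β` on `(𝓙, 𝓛)` has degree at least `n`."  Here
`β_{p, ℓ_{p,i}}` is written `β p i` (the chosen lines of `p` are indexed by `i`,
`lineAt_injective`),
"`p, p′ ∈ ℓ`" reads `ℓ_{p,i} = ℓ_{p′,i′} (= ℓ)`, and the sum in (b) runs over the incidences
`onLine ℓ`.  The hypothesis `𝓙 ≠ ∅` is added: for the empty configuration the printed statement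
fails (every nonzero constant vanishes to any order on it).
[cite: YuZhao2023JointsTightened, Lemma 2.1 (§2; arXiv v2, p. 3)] -/
theorem le_totalDegree_of_vanishesInFrame (cfg : JointsConfig F d) (hJ : cfg.J.Nonempty) (n : ℕ)
    (α : (Fin d → F) → ℤ) (β : (Fin d → F) → Fin d → ℕ)
    (ha : ∀ p ∈ cfg.J, ∀ p' ∈ cfg.J, ∀ i i', cfg.lineAt p i = cfg.lineAt p' i' → 0 < β p' i' →
      (β p' i' : ℤ) - α p' ≤ (β p i : ℤ) - α p)
    (hb : ∀ ℓ ∈ cfg.lines, n ≤ ∑ q ∈ cfg.onLine ℓ, β q.1 q.2)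
    {g : MvPolynomial (Fin d) F} (hg : g ≠ 0)
    (hvan : ∀ p ∈ cfg.J, VanishesInFrame g p (cfg.e p) (β p)) :
    n ≤ g.totalDegree := by
  classical
  -- the "bad" pairs `(p, γ)`: `g` does not vanish to order `γ ∈ ℤ_{>0}^d` at `p`; valued by
  -- `γ₁ + ⋯ + γ_d − α_p`
  set P : ℤ → Prop := fun m => ∃ p ∈ cfg.J, ∃ γ : Fin d → ℕ, (∀ j, 0 < γ j) ∧
    ¬ VanishesInFrame g p (cfg.e p) γ ∧ (∑ j, (γ j : ℤ)) - α p = m with hP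
  have hex : ∃ m, P m := by
    obtain ⟨p₀, hp₀⟩ := hJ
    obtain ⟨ω, hω⟩ := support_nonempty.2 (framePoly_ne_zero hg p₀ (cfg.isUnit_det hp₀))
    refine ⟨_, p₀, hp₀, fun j => ω j + 1, fun j => Nat.succ_pos _, fun hv => ?_, rfl⟩
    exact (mem_support_iff.1 hω) (hv ω fun j => Nat.lt_succ_self _)
  have hbdd : ∃ b, ∀ m, P m → b ≤ m := by
    refine ⟨-(∑ p ∈ cfg.J, |α p|), fun m ⟨p, hp, γ, _, _, hm⟩ => ?_⟩
    rw [← hm]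
    have h1 : |α p| ≤ ∑ p ∈ cfg.J, |α p| :=
      Finset.single_le_sum (f := fun p => |α p|) (fun _ _ => abs_nonneg _) hp
    have h2 : (0 : ℤ) ≤ ∑ j, (γ j : ℤ) := by positivity
    linarith [le_abs_self (α p)]
  obtain ⟨m₀, ⟨p, hp, γ, hγ, hbad, hval⟩, hmin⟩ := Int.exists_least_of_bdd hbdd hex
  -- minimality: at every joint all coefficients of smaller value vanish
  have hstar : ∀ p' ∈ cfg.J, ∀ ω : Fin d →₀ ℕ, (ω.degree : ℤ) + d - α p' < m₀ →
      coeff ω (framePoly p' (cfg.e p') g) = 0 := by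
    intro p' hp' ω hlt
    by_contra hne
    have hPω : P ((ω.degree : ℤ) + d - α p') := by
      refine ⟨p', hp', fun j => ω j + 1, fun j => Nat.succ_pos _, fun hv => ?_, ?_⟩
      · exact hne (hv ω fun j => Nat.lt_succ_self _)
      · push_cast
        rw [Finset.sum_add_distrib, Finsupp.degree_eq_sum]
        push_cast
        simp
    exact absurd (hmin _ hPω) (not_le.2 hlt)
  -- (3a) some chosen order at `p` is exceeded
  obtain ⟨i, hi⟩ : ∃ i, β p i < γ i := by
    by_contra! hle
    exact hbad ((hvan p hp).mono hle)
  -- (3b) the coefficient of `x^{γ − 1}` is nonzero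
  set h := framePoly p (cfg.e p) g with hh
  set θ₀ : Fin d →₀ ℕ := Finsupp.equivFunOnFinite.symm fun j => if j = i then 0 else γ j - 1
    with hθ₀
  have hθ₀i : θ₀ i = 0 := by simp [hθ₀]
  have hθ₀j : ∀ j, j ≠ i → θ₀ j = γ j - 1 := fun j hj => by simp [hθ₀, hj]
  have hsumγ : (∑ j, (γ j : ℤ)) = γ i + θ₀.degree + (d - 1 : ℕ) := by
    have hd : 1 ≤ d := Nat.one_le_of_lt i.isLt  -- hmm, Fin d nonempty
    rw [Finsupp.degree_eq_sum, ← Finset.add_sum_erase univ _ (mem_univ i),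
      ← Finset.add_sum_erase univ (fun j => θ₀ j) (mem_univ i), hθ₀i, zero_add]
    have hcard : (univ.erase i).card = d - 1 := by
      rw [Finset.card_erase_of_mem (mem_univ i), Finset.card_univ, Fintype.card_fin]
    have hrest : ∑ j ∈ univ.erase i, (γ j : ℤ) = ∑ j ∈ univ.erase i, ((θ₀ j : ℤ) + 1) := by
      refine Finset.sum_congr rfl fun j hj => ?_
      rw [hθ₀j j (Finset.ne_of_mem_erase hj)]
      have := hγ j
      omega
    rw [hrest, Finset.sum_add_distrib, Finset.sum_const, hcard]
    push_cast
    ring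
  have hcoeff : coeff (Finsupp.single i (γ i - 1) + θ₀) h ≠ 0 := by
    intro hzero
    apply hbad
    intro ω hω
    by_cases hωγ : ω = Finsupp.single i (γ i - 1) + θ₀
    · rw [hωγ]; exact hzero
    · apply hstar p hp ω
      rw [← hval]
      -- `|ω| + d < |γ|` since `ω < γ` componentwise and `ω ≠ γ − 1`
      have hle : ∀ j, ω j + 1 ≤ γ j := fun j => hω j
      have hlt' : ∃ j ∈ (univ : Finset (Fin d)), ω j + 1 < γ j := by
        by_contra! hge
        apply hωγ
        ext j
        have h1 := hle j
        have h2 := hge j (mem_univ j)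
        by_cases hji : j = i
        · subst hji
          rw [Finsupp.add_apply, Finsupp.single_eq_same, hθ₀i]
          omega
        · rw [Finsupp.add_apply, Finsupp.single_apply, if_neg (Ne.symm hji), hθ₀j j hji]
          omega
      have hsum : ∑ j, ((ω j : ℤ) + 1) < ∑ j, (γ j : ℤ) :=
        Finset.sum_lt_sum (fun j _ => by exact_mod_cast hle j)
          (by obtain ⟨j, hj, hjlt⟩ := hlt'; exact ⟨j, hj, by exact_mod_cast hjlt⟩)
      rw [Finset.sum_add_distrib, Finset.sum_const, Finset.card_univ, Fintype.card_fin,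
        nsmul_eq_mul, mul_one] at hsum
      rw [Finsupp.degree_eq_sum]
      push_cast
      linarith
  -- the univariate polynomial `f`: the `x'^{γ' − 1}`-slice of `h`, realised as the restriction of
  -- the Hasse derivative `∂^{θ₀} h` to the `i`-th axis
  set f : Polynomial F := aeval (axisSubst i) (hasseDeriv F θ₀ h) with hf
  have hfcoeff : ∀ k, f.coeff k = coeff (Finsupp.single i k + θ₀) h := by
    intro k
    rw [hf, coeff_aeval_axisSubst, coeff_hasseDeriv, mchoose_single_add hθ₀i, Nat.cast_one, one_mul]
  have hf0 : f ≠ 0 := by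
    intro h0
    apply hcoeff
    rw [← hfcoeff, h0, Polynomial.coeff_zero]
  have hdegf : f.natDegree + θ₀.degree ≤ g.totalDegree := by
    have hlead : f.coeff f.natDegree ≠ 0 := Polynomial.leadingCoeff_ne_zero.2 hf0
    rw [hfcoeff] at hlead
    have hle : (Finsupp.single i f.natDegree + θ₀).degree ≤ h.totalDegree :=
      le_totalDegree (mem_support_iff.2 hlead)
    rw [map_add, Finsupp.degree_single] at hle
    exact hle.trans (totalDegree_framePoly_le _ _ _)
  -- (4c) every incidence `(p', i')` of the line `ℓ = ℓ_{p,i}`, `p' = p + c eᵢ(p)`, contributes a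
  -- factor `(X − c)^{β_{p',ℓ}}` to `f`
  set ℓ := cfg.lineAt p i with hℓ
  have hd : 1 ≤ d := Fin.pos i
  have hdiv : ∀ q ∈ cfg.onLine ℓ, ∀ c : F, p + c • cfg.e p i = q.1 →
      (Polynomial.X - Polynomial.C c) ^ (β q.1 q.2) ∣ f := by
    rintro ⟨p', i'⟩ hq c hc
    obtain ⟨hp', hline⟩ := cfg.mem_onLine_iff.1 hq
    simp only at hp' hline hc ⊢
    rcases Nat.eq_zero_or_pos (β p' i') with hzero | hpos
    · rw [hzero, pow_zero]; exact one_dvd _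
    have hKI : (β p' i' : ℤ) - α p' ≤ (β p i : ℤ) - α p := ha p hp p' hp' i i' hline.symm hpos
    -- all coefficients of `g` at `p'` (in the frame of `p'`) of degree `< β' + D` vanish
    have hlow' : ∀ s ∈ (framePoly p' (cfg.e p') g).support, β p' i' + θ₀.degree ≤ s.degree := by
      intro s hs
      by_contra! hlt
      refine (mem_support_iff.1 hs) (hstar p' hp' s ?_)
      rw [← hval, hsumγ]
      omega
    -- hence `g` vanishes to order `β' + D` at `p'` — in any frame, in particular in `p`'s frame,
    -- where `p' = p + c eᵢ`: this is vanishing of `h` at the point `c δᵢ`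
    have hvto : VanishesToOrder g p' (β p' i' + θ₀.degree) :=
      (vanishesToOrder_iff_framePoly g p' (cfg.isUnit_det hp') _).2 hlow'
    have hlow : ∀ s ∈ (framePoly p' (cfg.e p) g).support, β p' i' + θ₀.degree ≤ s.degree :=
      (vanishesToOrder_iff_framePoly g p' (cfg.isUnit_det hp) _).1 hvto
    have hvh : VanishesToOrder h (Pi.single i c) (β p' i' + θ₀.degree) := by
      intro s hs
      rw [hh, ← framePoly_add_smul, hc] at hs
      exact hlow s hs
    have hvD : VanishesToOrder (hasseDeriv F θ₀ h) ((0 : Fin d → F) + c • Pi.single i 1)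
        (β p' i') := by
      have hpt : (0 : Fin d → F) + c • (Pi.single i 1 : Fin d → F) = Pi.single i c := by
        ext j; simp [Pi.single_apply]
      have := hvh.hasseDeriv θ₀
      rwa [Nat.add_sub_cancel, ← hpt] at this
    exact X_sub_C_pow_dvd_aeval_line (0 : Fin d → F) (Pi.single i 1) c (hasseDeriv F θ₀ h) hvD
  -- the scalars `c_q` with `q.1 = p + c_q eᵢ(p)`, pairwise distinct
  have hc_ex : ∀ q ∈ cfg.onLine ℓ, ∃ c : F, p + c • cfg.e p i = q.1 := fun q hq =>
    cfg.exists_eq_add_smul_of_mem_onLine hq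
  choose! c hc using hc_ex
  have hcinj : ∀ q ∈ cfg.onLine ℓ, ∀ q' ∈ cfg.onLine ℓ, c q = c q' → q = q' := by
    intro q hq q' hq' hcc
    apply cfg.eq_of_mem_onLine_of_fst_eq hq hq'
    rw [← hc q hq, ← hc q' hq', hcc]
  have hcop : (↑(cfg.onLine ℓ) : Set ((Fin d → F) × Fin d)).Pairwise
      (Function.onFun IsCoprime fun q => (Polynomial.X - Polynomial.C (c q)) ^ (β q.1 q.2)) := by
    intro q hq q' hq' hne
    have hcc : c q ≠ c q' := fun h => hne (hcinj q hq q' hq' h)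
    exact (Polynomial.pairwise_coprime_X_sub_C (K := F) (s := id) Function.injective_id hcc).pow
  have hprod : ∏ q ∈ cfg.onLine ℓ, (Polynomial.X - Polynomial.C (c q)) ^ (β q.1 q.2) ∣ f :=
    Finset.prod_dvd_of_coprime hcop fun q hq => hdiv q hq (c q) (hc q hq)
  have hdegprod : (∏ q ∈ cfg.onLine ℓ,
      (Polynomial.X - Polynomial.C (c q)) ^ (β q.1 q.2)).natDegree =
        ∑ q ∈ cfg.onLine ℓ, β q.1 q.2 := by
    rw [Polynomial.natDegree_prod_of_monic _ _ fun q _ => (Polynomial.monic_X_sub_C (c q)).pow _]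
    simp only [Polynomial.natDegree_pow, Polynomial.natDegree_X_sub_C, mul_one]
  have h1 := Polynomial.natDegree_le_of_dvd hprod hf0
  rw [hdegprod] at h1
  have h2 := hb ℓ (cfg.lineAt_mem_lines hp i)
  omega

end Vanishing

/-! ### Lemma 2.2: parameter counting -/
section Counting

/-- The box of exponent vectors `{ω : ωᵢ < βᵢ for all i}`. [folklore] -/
noncomputable def box (β : Fin d → ℕ) : Finset (Fin d →₀ ℕ) :=
  (Fintype.piFinset fun i => Finset.range (β i)).map Finsupp.equivFunOnFinite.symm.toEmbedding

/-- Membership in the box. [folklore] -/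
private theorem mem_box_iff {β : Fin d → ℕ} {ω : Fin d →₀ ℕ} : ω ∈ box β ↔ ∀ i, ω i < β i := by
  unfold box
  rw [Finset.mem_map]
  constructor
  · rintro ⟨f, hf, rfl⟩
    intro i
    rw [Fintype.mem_piFinset] at hf
    simpa using hf i
  · intro h
    refine ⟨ω, Fintype.mem_piFinset.2 fun i => Finset.mem_range.2 (h i), ?_⟩
    simp

/-- The box has `∏ᵢ βᵢ` elements ("a set of `∏_{ℓ ∋ p} β_{p,ℓ}` linear constraints").
[cite: YuZhao2023JointsTightened, Lemma 2.2 (proof; arXiv v2, p. 3)] -/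
theorem card_box (β : Fin d → ℕ) : (box β).card = ∏ i, β i := by
  unfold box
  rw [Finset.card_map, Fintype.card_piFinset]
  simp only [Finset.card_range]

/-- **Lemma 2.2 (Yu–Zhao).** "Assuming the same setup as Lemma 2.1, one has
`∑_{p ∈ 𝓙} ∏_{ℓ ∋ p} β_{p,ℓ} ≥ C(n + d − 1, d)`."  (Proof as printed: the polynomials of degree
`< n` form a space of dimension `C(n + d − 1, d)`; vanishing to order `β` on `(𝓙, 𝓛)` is a set of
`∑_p ∏_{ℓ ∋ p} β_{p,ℓ}` linear constraints; a nonzero solution would contradict Lemma 2.1.)  As in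
Lemma 2.1 the hypothesis `𝓙 ≠ ∅` is added (the printed inequality fails for the empty
configuration when `n, d ≥ 1`). [cite: YuZhao2023JointsTightened, Lemma 2.2 (§2; arXiv v2, p. 3)] -/
theorem choose_le_sum_prod (cfg : JointsConfig F d) (hJ : cfg.J.Nonempty) (n : ℕ)
    (α : (Fin d → F) → ℤ) (β : (Fin d → F) → Fin d → ℕ)
    (ha : ∀ p ∈ cfg.J, ∀ p' ∈ cfg.J, ∀ i i', cfg.lineAt p i = cfg.lineAt p' i' → 0 < β p' i' →
      (β p' i' : ℤ) - α p' ≤ (β p i : ℤ) - α p)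
    (hb : ∀ ℓ ∈ cfg.lines, n ≤ ∑ q ∈ cfg.onLine ℓ, β q.1 q.2) :
    (n + d - 1).choose d ≤ ∑ p ∈ cfg.J, ∏ i, β p i := by
  classical
  rcases Nat.eq_zero_or_pos n with rfl | hn
  · rcases Nat.eq_zero_or_pos d with hd | hd
    · subst hd
      simp only [zero_add, Nat.choose_zero_right, Finset.univ_eq_empty, Finset.prod_empty,
        Finset.sum_const, smul_eq_mul, mul_one]
      exact hJ.card_pos
    · rw [Nat.choose_eq_zero_of_lt (by omega)]
      exact Nat.zero_le _
  by_contra! hlt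
  set V := restrictTotalDegree (Fin d) F (n - 1) with hV
  set T := cfg.J.sigma fun p => box (β p) with hT
  have hTcard : T.card = ∑ p ∈ cfg.J, ∏ i, β p i := by
    rw [hT, Finset.card_sigma]
    exact Finset.sum_congr rfl fun p _ => card_box (β p)
  let Φ : V →ₗ[F] (↥T → F) := LinearMap.pi fun t : ↥T =>
    (lcoeff F t.1.2).comp ((aeval (R := F) (affineSubst (cfg.e t.1.1) t.1.1)).toLinearMap.comp
      V.subtype)
  have hdim : Module.finrank F (↥T → F) < Module.finrank F V := by
    rw [Module.finrank_fintype_fun_eq_card, Fintype.card_coe, hTcard]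
    calc ∑ p ∈ cfg.J, ∏ i, β p i < (n + d - 1).choose d := hlt
      _ = (n - 1 + d).choose d := by congr 1; omega
      _ ≤ Module.finrank F V := choose_le_finrank_restrictTotalDegree d (n - 1)
  obtain ⟨g, hgker, hg0⟩ :=
    (Submodule.ne_bot_iff _).1 (LinearMap.ker_ne_bot_of_finrank_lt (f := Φ) hdim)
  have hg0' : (g : MvPolynomial (Fin d) F) ≠ 0 := fun h => hg0 (Subtype.ext h)
  have hvan : ∀ p ∈ cfg.J, VanishesInFrame (g : MvPolynomial (Fin d) F) p (cfg.e p) (β p) := by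
    intro p hp ω hω
    have hmem : (⟨p, ω⟩ : Σ _ : Fin d → F, Fin d →₀ ℕ) ∈ T :=
      Finset.mem_sigma.2 ⟨hp, mem_box_iff.2 hω⟩
    have hΦ : Φ g = 0 := LinearMap.mem_ker.1 hgker
    have hc := congr_fun hΦ ⟨⟨p, ω⟩, hmem⟩
    simpa only [Φ, LinearMap.pi_apply, LinearMap.comp_apply, Submodule.subtype_apply,
      AlgHom.toLinearMap_apply, lcoeff_apply, Pi.zero_apply, framePoly_eq] using hc
  have hdeg := le_totalDegree_of_vanishesInFrame cfg hJ n α β ha hb hg0' hvan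
  have hle : (g : MvPolynomial (Fin d) F).totalDegree ≤ n - 1 :=
    (mem_restrictTotalDegree _ _ _).1 g.2
  omega

/-- **Remark after Lemma 2.2** ("setting `β_{p,ℓ} = 1` for all `(p, ℓ)` in Lemma 2.2 yields
`|𝓙| ≥ C(n + d − 1, d)`" when "every line in `𝓛` contains exactly the same number `n` of
joints"): if every line of a nonempty configuration carries at least `n` incidences then
`|𝓙| ≥ C(n + d − 1, d)`.
[cite: YuZhao2023JointsTightened, Remark after Lemma 2.2 (§2; arXiv v2, p. 4)] -/
theorem choose_le_card (cfg : JointsConfig F d) (hJ : cfg.J.Nonempty) (n : ℕ)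
    (hn : ∀ ℓ ∈ cfg.lines, n ≤ (cfg.onLine ℓ).card) : (n + d - 1).choose d ≤ cfg.J.card := by
  have h := choose_le_sum_prod cfg hJ n (fun _ => 0) (fun _ _ => 1)
    (fun _ _ _ _ _ _ _ _ => le_rfl) (fun ℓ hℓ => by simpa using hn ℓ hℓ)
  simpa using h

end Counting

/-! ### Lemma 2.3: the continuous inequality -/
section Continuous

open Filter Topology

/-- `C(N + d − 1, d) / N^d → 1/d!` as `N → ∞`.
[cite: YuZhao2023JointsTightened, Lemma 2.3 (proof; arXiv v2, p. 4: "Taking `n → ∞`")] -/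
theorem tendsto_choose_div_pow (d : ℕ) :
    Tendsto (fun N : ℕ => ((N + d - 1).choose d : ℝ) / (N : ℝ) ^ d) atTop
      (𝓝 ((1 : ℝ) / d.factorial)) := by
  have hfac : (d.factorial : ℝ) ≠ 0 := by positivity
  -- for `N ≥ 1` the quotient is `(1/d!) ∏_{j<d} (1 + j/N)`
  have heq : ∀ N : ℕ, 1 ≤ N → ((N + d - 1).choose d : ℝ) / (N : ℝ) ^ d =
      (1 / d.factorial) * ∏ j ∈ Finset.range d, (1 + (j : ℝ) / N) := by
    intro N hN
    have hN : (N : ℝ) ≠ 0 := by exact_mod_cast (show N ≠ 0 by omega)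
    have h := factorial_mul_choose_eq_prod N d
    have hprod : ∏ j ∈ Finset.range d, (1 + (j : ℝ) / N) =
        (∏ j ∈ Finset.range d, ((N : ℝ) + j)) / (N : ℝ) ^ d := by
      rw [show (N : ℝ) ^ d = ∏ _j ∈ Finset.range d, (N : ℝ) by
        rw [Finset.prod_const, Finset.card_range], ← Finset.prod_div_distrib]
      exact Finset.prod_congr rfl fun j _ => by field_simp
    rw [hprod, ← h]
    field_simp
  have hlim : Tendsto (fun N : ℕ => (1 / (d.factorial : ℝ)) * ∏ j ∈ Finset.range d,
      (1 + (j : ℝ) / N)) atTop (𝓝 ((1 / d.factorial) * ∏ j ∈ Finset.range d, (1 : ℝ))) := by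
    refine Tendsto.const_mul _ (tendsto_finsetProd _ fun j _ => ?_)
    simpa using tendsto_const_nhds.add (tendsto_const_div_atTop_nhds_zero_nat (j : ℝ))
  rw [Finset.prod_const_one, mul_one] at hlim
  refine hlim.congr' ?_
  filter_upwards [eventually_ge_atTop 1] with N hN
  exact (heq N hN).symm

/-- **Lemma 2.3 (Yu–Zhao).** "Let `(𝓙, 𝓛)` be a joints configuration in `𝔽^d`. Suppose
`a_p ∈ ℝ` for each `p ∈ 𝓙` and `b_{p,ℓ} ∈ ℝ_{≥0}` for each `(p, ℓ) ∈ 𝓙 × 𝓛` with `p ∈ ℓ` satisfy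
(a) `b_{p,ℓ} − a_p = b_{p′,ℓ} − a_{p′}` whenever `p, p′ ∈ ℓ` and `b_{p′,ℓ} > 0`, and
(b) `∑_{p : p ∈ ℓ} b_{p,ℓ} = 1` for every `ℓ ∈ 𝓛`. Then `∑_{p ∈ 𝓙} ∏_{ℓ ∋ p} b_{p,ℓ} ≥ 1/d!`."
(Proof as printed: apply Lemma 2.2 with `α_p = ⌈a_p n⌉`, `β_{p,ℓ} = b_{p,ℓ} n + O(1)` and let
`n → ∞`.)  `𝓙 ≠ ∅` is added as in Lemmas 2.1–2.2.
[cite: YuZhao2023JointsTightened, Lemma 2.3 (§2; arXiv v2, p. 4)] -/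
theorem inv_factorial_le_sum_prod (cfg : JointsConfig F d) (hJ : cfg.J.Nonempty)
    (a : (Fin d → F) → ℝ) (b : (Fin d → F) → Fin d → ℝ) (hb0 : ∀ p ∈ cfg.J, ∀ i, 0 ≤ b p i)
    (ha : ∀ p ∈ cfg.J, ∀ p' ∈ cfg.J, ∀ i i', cfg.lineAt p i = cfg.lineAt p' i' → 0 < b p' i' →
      b p i - a p = b p' i' - a p')
    (hb : ∀ ℓ ∈ cfg.lines, ∑ q ∈ cfg.onLine ℓ, b q.1 q.2 = 1) :
    (1 : ℝ) / d.factorial ≤ ∑ p ∈ cfg.J, ∏ i, b p i := by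
  classical
  -- on every line some incidence has positive weight; the common value `λ_ℓ = b_{p,ℓ} − a_p`
  have hpos : ∀ ℓ ∈ cfg.lines, ∃ q ∈ cfg.onLine ℓ, 0 < b q.1 q.2 := by
    intro ℓ hℓ
    by_contra! hle
    have := Finset.sum_nonpos hle
    linarith [hb ℓ hℓ]
  have hlam : ∀ ℓ ∈ cfg.lines, ∃ lamℓ : ℝ, ∀ q ∈ cfg.onLine ℓ, b q.1 q.2 = a q.1 + lamℓ := by
    intro ℓ hℓ
    obtain ⟨q₀, hq₀, hq₀pos⟩ := hpos ℓ hℓ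
    refine ⟨b q₀.1 q₀.2 - a q₀.1, fun q hq => ?_⟩
    obtain ⟨hqJ, hqℓ⟩ := cfg.mem_onLine_iff.1 hq
    obtain ⟨hq₀J, hq₀ℓ⟩ := cfg.mem_onLine_iff.1 hq₀
    have := ha q.1 hqJ q₀.1 hq₀J q.2 q₀.2 (hqℓ.trans hq₀ℓ.symm) hq₀pos
    linarith
  choose! lam hlin using hlam
  -- the integer data at level `N`
  set αN : ℕ → (Fin d → F) → ℤ := fun N p => ⌈a p * N⌉ with hαN
  set ΛN : ℕ → Set (Fin d → F) → ℤ := fun N ℓ => ⌈lam ℓ * N⌉ + 1 with hΛN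
  set βN : ℕ → (Fin d → F) → Fin d → ℕ := fun N p i => (αN N p + ΛN N (cfg.lineAt p i)).toNat
    with hβN
  -- Lemma 2.2 applies at every level
  have hcount : ∀ N : ℕ, ((N + d - 1).choose d : ℝ) ≤ ∑ p ∈ cfg.J, ∏ i, (βN N p i : ℝ) := by
    intro N
    have h := choose_le_sum_prod cfg hJ N (αN N) (βN N) ?_ ?_
    · exact_mod_cast h
    · intro p hp p' hp' i i' hline hpos'
      have h1 : ((βN N p' i' : ℕ) : ℤ) = αN N p' + ΛN N (cfg.lineAt p' i') := by
        apply Int.toNat_of_nonneg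
        have := Int.lt_toNat.1 hpos'
        push_cast at this
        exact this.le
      have h2 : αN N p + ΛN N (cfg.lineAt p i) ≤ ((βN N p i : ℕ) : ℤ) := Int.self_le_toNat _
      rw [hline] at h2
      omega
    · intro ℓ hℓ
      have hsum : ((N : ℝ)) ≤ ∑ q ∈ cfg.onLine ℓ, (βN N q.1 q.2 : ℝ) := by
        calc (N : ℝ) = ∑ q ∈ cfg.onLine ℓ, b q.1 q.2 * N := by
              rw [← Finset.sum_mul, hb ℓ hℓ, one_mul]
          _ ≤ ∑ q ∈ cfg.onLine ℓ, (βN N q.1 q.2 : ℝ) := by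
            refine Finset.sum_le_sum fun q hq => ?_
            obtain ⟨-, hqℓ⟩ := cfg.mem_onLine_iff.1 hq
            have h2 : ((αN N q.1 + ΛN N (cfg.lineAt q.1 q.2) : ℤ) : ℝ) ≤ (βN N q.1 q.2 : ℝ) := by
              have := Int.self_le_toNat (αN N q.1 + ΛN N (cfg.lineAt q.1 q.2))
              exact_mod_cast this
            rw [hqℓ] at h2
            have h3 : a q.1 * N ≤ (αN N q.1 : ℝ) := Int.le_ceil _
            have h4 : lam ℓ * N ≤ (⌈lam ℓ * N⌉ : ℝ) := Int.le_ceil _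
            rw [hlin ℓ hℓ q hq]
            push_cast [hαN, hΛN] at h2 ⊢
            nlinarith
      exact_mod_cast hsum
  -- the weights at level `N` are `b N + O(1)`
  have hupper : ∀ N : ℕ, ∀ p ∈ cfg.J, ∀ i, (βN N p i : ℝ) ≤ b p i * N + 3 := by
    intro N p hp i
    set x : ℤ := αN N p + ΛN N (cfg.lineAt p i) with hx
    have hxR : (x : ℝ) ≤ b p i * N + 3 := by
      have h3 := Int.ceil_lt_add_one (a p * N)
      have h4 := Int.ceil_lt_add_one (lam (cfg.lineAt p i) * N)
      have h5 := hlin (cfg.lineAt p i) (cfg.lineAt_mem_lines hp i) (p, i) (cfg.mem_onLine_self hp i)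
      simp only at h5
      rw [h5]
      push_cast [hx, hαN, hΛN]
      linarith
    have h1 : ((x.toNat : ℕ) : ℤ) = max x 0 := Int.toNat_eq_max x
    have h2 : ((x.toNat : ℕ) : ℝ) = ((max x 0 : ℤ) : ℝ) := by exact_mod_cast h1
    show ((x.toNat : ℕ) : ℝ) ≤ _
    rw [h2]
    push_cast
    refine max_le hxR ?_
    have := hb0 p hp i
    positivity
  -- divide by `N^d` and let `N → ∞`
  have hineq : ∀ N : ℕ, 1 ≤ N → ((N + d - 1).choose d : ℝ) / (N : ℝ) ^ d ≤
      ∑ p ∈ cfg.J, ∏ i, (b p i + 3 / N) := by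
    intro N hN
    have hNpos : (0 : ℝ) < N := by exact_mod_cast hN
    rw [div_le_iff₀ (pow_pos hNpos d), Finset.sum_mul]
    refine (hcount N).trans (Finset.sum_le_sum fun p hp => ?_)
    rw [show (N : ℝ) ^ d = ∏ _i : Fin d, (N : ℝ) by
      rw [Finset.prod_const, Finset.card_univ, Fintype.card_fin], ← Finset.prod_mul_distrib]
    refine Finset.prod_le_prod (fun i _ => Nat.cast_nonneg _) fun i _ => ?_
    calc (βN N p i : ℝ) ≤ b p i * N + 3 := hupper N p hp i
      _ = (b p i + 3 / N) * N := by field_simp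
  have hlimR : Tendsto (fun N : ℕ => ∑ p ∈ cfg.J, ∏ i, (b p i + 3 / (N : ℝ))) atTop
      (𝓝 (∑ p ∈ cfg.J, ∏ i, b p i)) := by
    refine tendsto_finsetSum _ fun p _ => tendsto_finsetProd _ fun i _ => ?_
    simpa using tendsto_const_nhds.add (tendsto_const_div_atTop_nhds_zero_nat (3 : ℝ))
  refine le_of_tendsto_of_tendsto (tendsto_choose_div_pow d) hlimR ?_
  filter_upwards [eventually_ge_atTop 1] with N hN
  exact hineq N hN

end Continuous

/-! ### Lemma 2.4: equal weights on a connected configuration -/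
section Connected

open Filter Topology

namespace JointsConfig

/-- **Connected joints configuration** (Yu–Zhao, §2: "`(𝓙, 𝓛)` is connected if the graph
constructed by taking `𝓙` as vertices, with `p, p′ ∈ 𝓙` adjacent if there is some `ℓ ∈ 𝓛`
containing both `p` and `p′`, is connected"), stated as the equivalent cut condition: every
nonempty proper subset of `𝓙` contains a joint sharing a chosen line with a joint outside it.
[cite: YuZhao2023JointsTightened, §2 (arXiv v2, p. 4, before Lemma 2.4)] -/
def IsConnected (cfg : JointsConfig F d) : Prop :=
  ∀ S ⊆ cfg.J, S.Nonempty → S ≠ cfg.J →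
    ∃ p ∈ S, ∃ p' ∈ cfg.J, p' ∉ S ∧ ∃ i i', cfg.lineAt p i = cfg.lineAt p' i'

/-! #### The variational problem of Lemma 2.4

The weights `b_{p,ℓ}` are indexed by the finite type of incidences `↥J × Fin d`; hypothesis (a)
(in its symmetric form `b_{p,ℓ} = a_p + λ_ℓ`) is the range of the linear map `weightMap`, and
the feasible set `B` of the printed proof is `feasible`. -/

/-- The line `ℓ_{p,i}` of the incidence `(p, i)`, `p ∈ J`. [folklore] -/
def incLine (cfg : JointsConfig F d) (q : ↥cfg.J × Fin d) : Set (Fin d → F) :=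
  cfg.lineAt q.1 q.2

open scoped Classical in
/-- The incidences of the line `ℓ`, as a finset of the finite index type `↥J × Fin d`. [folklore] -/
noncomputable def incOn (cfg : JointsConfig F d) (ℓ : Set (Fin d → F)) : Finset (↥cfg.J × Fin d) :=
  univ.filter fun q => cfg.incLine q = ℓ

/-- The linear parametrisation `(a, λ) ↦ (a_p + λ_ℓ)_{(p, ℓ) : p ∈ ℓ}` of the weights allowed by
hypothesis (a) ("the existence of `(a_p)` satisfying (a) is equivalent to a finite set of linear
constraints on `b`"). [cite: YuZhao2023JointsTightened, Lemma 2.4 (proof; arXiv v2, pp. 4–5)] -/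
noncomputable def weightMap (cfg : JointsConfig F d) :
    (((Fin d → F) → ℝ) × (Set (Fin d → F) → ℝ)) →ₗ[ℝ] (↥cfg.J × Fin d → ℝ) where
  toFun x q := x.1 q.1 + x.2 (cfg.incLine q)
  map_add' x y := by
    funext q
    simp only [Prod.fst_add, Prod.snd_add, Pi.add_apply]
    ring
  map_smul' c x := by
    funext q
    simp only [Prod.smul_fst, Prod.smul_snd, Pi.smul_apply, smul_eq_mul, RingHom.id_apply]
    ring

/-- **The feasible set `B`** of the proof of Lemma 2.4: nonnegative weights, summing to `1` on
every line (hypothesis (b)), of the form `a_p + λ_ℓ` (hypothesis (a)).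
[cite: YuZhao2023JointsTightened, Lemma 2.4 (proof; arXiv v2, pp. 4–5)] -/
def feasible (cfg : JointsConfig F d) : Set (↥cfg.J × Fin d → ℝ) :=
  {b | (∀ q, 0 ≤ b q) ∧ (∀ ℓ ∈ cfg.lines, ∑ q ∈ cfg.incOn ℓ, b q = 1) ∧
    b ∈ LinearMap.range cfg.weightMap}

/-- **The objective `max_{p ∈ 𝓙} ∏_{ℓ ∋ p} b_{p,ℓ}`** (eq. (2) of the paper).
[cite: YuZhao2023JointsTightened, Lemma 2.4 (proof, eq. (2); arXiv v2, p. 4)] -/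
noncomputable def maxProd (cfg : JointsConfig F d) (hJ : cfg.J.Nonempty)
    (b : ↥cfg.J × Fin d → ℝ) : ℝ :=
  (univ : Finset ↥cfg.J).sup' (Finset.univ_nonempty_iff.2 hJ.coe_sort) fun p => ∏ i, b (p, i)

section Variational

variable (cfg : JointsConfig F d)

/-- Membership in `incOn`. [cite: YuZhao2023JointsTightened, §2 (arXiv v2, p. 2)] -/
theorem mem_incOn_iff {ℓ : Set (Fin d → F)} {q : ↥cfg.J × Fin d} :
    q ∈ cfg.incOn ℓ ↔ cfg.incLine q = ℓ := by
  unfold incOn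
  simp only [Finset.mem_filter, mem_univ, true_and]

/-- Unfolding `incLine`. [cite: YuZhao2023JointsTightened, §2 (arXiv v2, p. 2)] -/
theorem incLine_eq (q : ↥cfg.J × Fin d) : cfg.incLine q = cfg.lineAt q.1 q.2 := rfl

/-- The line of an incidence is a line of the configuration. [folklore] -/
private theorem incLine_mem_lines (q : ↥cfg.J × Fin d) : cfg.incLine q ∈ cfg.lines :=
  cfg.lineAt_mem_lines q.1.2 q.2

/-- Every line of the configuration has an incidence. [folklore] -/
private theorem card_incOn_pos {ℓ : Set (Fin d → F)} (hℓ : ℓ ∈ cfg.lines) : 0 <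
    (cfg.incOn ℓ).card := by
  obtain ⟨p, hp, i, rfl⟩ := cfg.mem_lines_iff.1 hℓ
  exact Finset.card_pos.2 ⟨(⟨p, hp⟩, i), cfg.mem_incOn_iff.2 rfl⟩

/-- Unfolding `weightMap`. [folklore] -/
private theorem weightMap_apply (x : ((Fin d → F) → ℝ) × (Set (Fin d → F) → ℝ))
    (q : ↥cfg.J × Fin d) :
    cfg.weightMap x q = x.1 q.1 + x.2 (cfg.incLine q) :=
  rfl

/-- Sums over the incidences of a line, transported to the index type `↥J × Fin d`.
[cite: YuZhao2023JointsTightened, §2 (arXiv v2, p. 2)] -/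
theorem sum_onLine_eq (ℓ : Set (Fin d → F)) (f : (Fin d → F) × Fin d → ℝ) :
    ∑ q ∈ cfg.onLine ℓ, f q = ∑ q ∈ cfg.incOn ℓ, f (q.1, q.2) := by
  classical
  refine Finset.sum_bij' (fun q hq => (⟨q.1, (cfg.mem_onLine_iff.1 hq).1⟩, q.2))
    (fun q _ => ((q.1 : Fin d → F), q.2)) ?_ ?_ ?_ ?_ ?_
  · intro q hq
    exact cfg.mem_incOn_iff.2 (cfg.mem_onLine_iff.1 hq).2
  · intro q hq
    exact cfg.mem_onLine_iff.2 ⟨q.1.2, cfg.mem_incOn_iff.1 hq⟩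
  · intro q hq; rfl
  · intro q hq; rfl
  · intro q hq; rfl

/-- A feasible weight lies in `[0, 1]`.
[cite: YuZhao2023JointsTightened, Lemma 2.4 (proof; arXiv v2, p. 4: `B ⊆ [0,1]^{d|𝓙|}`)] -/
theorem feasible_subset_pi : cfg.feasible ⊆ Set.pi Set.univ (fun _ => Set.Icc (0 : ℝ) 1) := by
  intro b hb q _
  refine ⟨hb.1 q, ?_⟩
  calc b q ≤ ∑ q' ∈ cfg.incOn (cfg.incLine q), b q' :=
        Finset.single_le_sum (fun q' _ => hb.1 q') (cfg.mem_incOn_iff.2 rfl)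
    _ = 1 := hb.2.1 _ (cfg.incLine_mem_lines q)

/-- **`B` is compact** ("The set `B` is closed since the existence of `(a_p) ∈ ℝ^{|𝓙|}` satisfying
(a) is equivalent to a finite set of linear constraints on `b`"; and `B ⊆ [0,1]^{d|𝓙|}`).
[cite: YuZhao2023JointsTightened, Lemma 2.4 (proof; arXiv v2, pp. 4–5)] -/
theorem isCompact_feasible : IsCompact cfg.feasible := by
  classical
  have h1 : IsClosed {b : ↥cfg.J × Fin d → ℝ | ∀ q, 0 ≤ b q} := by
    rw [Set.setOf_forall]
    exact isClosed_iInter fun q => isClosed_le continuous_const (continuous_apply q)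
  have h2 : IsClosed {b : ↥cfg.J × Fin d → ℝ | ∀ ℓ ∈ cfg.lines, ∑ q ∈ cfg.incOn ℓ, b q = 1} := by
    have : {b : ↥cfg.J × Fin d → ℝ | ∀ ℓ ∈ cfg.lines, ∑ q ∈ cfg.incOn ℓ, b q = 1} =
        ⋂ ℓ ∈ cfg.lines, {b | ∑ q ∈ cfg.incOn ℓ, b q = 1} := by
      ext b
      simp only [Set.mem_setOf_eq, Set.mem_iInter]
    rw [this]
    exact isClosed_biInter fun ℓ _ =>
      isClosed_eq (continuous_finsetSum _ fun q _ => continuous_apply q) continuous_const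
  have h3 : IsClosed (LinearMap.range cfg.weightMap : Set (↥cfg.J × Fin d → ℝ)) :=
    (LinearMap.range cfg.weightMap).closed_of_finiteDimensional
  have hBeq : cfg.feasible = {b | ∀ q, 0 ≤ b q} ∩
      ({b | ∀ ℓ ∈ cfg.lines, ∑ q ∈ cfg.incOn ℓ, b q = 1} ∩
        (LinearMap.range cfg.weightMap : Set (↥cfg.J × Fin d → ℝ))) := by
    ext b
    simp only [feasible, Set.mem_setOf_eq, Set.mem_inter_iff, SetLike.mem_coe]
  have hclosed : IsClosed cfg.feasible := by
    rw [hBeq]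
    exact h1.inter (h2.inter h3)
  exact (isCompact_univ_pi fun _ => isCompact_Icc).of_isClosed_subset hclosed
    cfg.feasible_subset_pi

/-- **`B` is nonempty** ("setting all `b_{p,ℓ} = |ℓ ∩ 𝓙|^{−1}` and `a_p = 0` is feasible").
[cite: YuZhao2023JointsTightened, Lemma 2.4 (proof; arXiv v2, pp. 4–5)] -/
theorem feasible_nonempty : cfg.feasible.Nonempty := by
  classical
  refine ⟨cfg.weightMap (0, fun ℓ => 1 / (cfg.incOn ℓ).card), fun q => ?_, fun ℓ hℓ => ?_,
    LinearMap.mem_range_self _ _⟩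
  · rw [weightMap_apply]
    simp only [Pi.zero_apply, zero_add]
    positivity
  · simp_rw [weightMap_apply]
    simp only [Pi.zero_apply, zero_add]
    rw [Finset.sum_congr rfl fun q hq => by rw [cfg.mem_incOn_iff.1 hq], Finset.sum_const,
      nsmul_eq_mul]
    have := cfg.card_incOn_pos hℓ
    field_simp

/-- The objective is continuous. [folklore] -/
private theorem continuous_maxProd (hJ : cfg.J.Nonempty) : Continuous (cfg.maxProd hJ) :=
  Continuous.finset_sup'_apply _ fun p _ =>
    continuous_finsetProd _ fun i _ => continuous_apply (p, i)

/-- Each product is at most the maximum. [folklore] -/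
private theorem prod_le_maxProd (hJ : cfg.J.Nonempty) (b : ↥cfg.J × Fin d → ℝ) (p : ↥cfg.J) :
    ∏ i, b (p, i) ≤ cfg.maxProd hJ b :=
  Finset.le_sup' (fun p => ∏ i, b (p, i)) (mem_univ p)

/-- The maximum is attained. [folklore] -/
private theorem exists_prod_eq_maxProd (hJ : cfg.J.Nonempty) (b : ↥cfg.J × Fin d → ℝ) :
    ∃ p : ↥cfg.J, ∏ i, b (p, i) = cfg.maxProd hJ b := by
  obtain ⟨p, -, hp⟩ := Finset.exists_mem_eq_sup' (Finset.univ_nonempty_iff.2 hJ.coe_sort)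
    fun p : ↥cfg.J => ∏ i, b (p, i)
  exact ⟨p, hp.symm⟩

/-- A feasible weight `b = weightMap (a, λ)`, read as functions of the point and the direction,
satisfies the hypotheses of Lemma 2.3 (with (a) for all pairs of incidences of a line).
[folklore] -/
private theorem hypotheses_of_feasible {b : ↥cfg.J × Fin d → ℝ} (hb : b ∈ cfg.feasible)
    {x : ((Fin d → F) → ℝ) × (Set (Fin d → F) → ℝ)} (hx : cfg.weightMap x = b) :
    (∀ p ∈ cfg.J, ∀ i, 0 ≤ x.1 p + x.2 (cfg.lineAt p i)) ∧
    (∀ p ∈ cfg.J, ∀ p' ∈ cfg.J, ∀ i i', cfg.lineAt p i = cfg.lineAt p' i' →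
      x.1 p + x.2 (cfg.lineAt p i) - x.1 p = x.1 p' + x.2 (cfg.lineAt p' i') - x.1 p') ∧
    (∀ ℓ ∈ cfg.lines, ∑ q ∈ cfg.onLine ℓ, (x.1 q.1 + x.2 (cfg.lineAt q.1 q.2)) = 1) ∧
    (∀ (p : Fin d → F) (hp : p ∈ cfg.J) i, b (⟨p, hp⟩, i) = x.1 p + x.2 (cfg.lineAt p i)) := by
  have hbq : ∀ q, b q = x.1 q.1 + x.2 (cfg.lineAt q.1 q.2) := fun q => by
    rw [← hx, weightMap_apply, incLine_eq]
  refine ⟨fun p hp i => ?_, fun p _ p' _ i i' hline => by rw [hline]; ring, fun ℓ hℓ => ?_,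
    fun p hp i => hbq _⟩
  · have := hb.1 (⟨p, hp⟩, i)
    rwa [hbq] at this
  · rw [cfg.sum_onLine_eq]
    have := hb.2.1 ℓ hℓ
    simpa only [hbq] using this

/-- **The objective is positive on `B`** (by Lemma 2.3, `∑_p ∏_{ℓ ∋ p} b_{p,ℓ} ≥ 1/d! > 0`).
[cite: YuZhao2023JointsTightened, Lemma 2.4 (proof; arXiv v2, pp. 4–5)] -/
theorem maxProd_pos (hJ : cfg.J.Nonempty) {b : ↥cfg.J × Fin d → ℝ} (hb : b ∈ cfg.feasible) :
    0 < cfg.maxProd hJ b := by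
  obtain ⟨x, hx⟩ := LinearMap.mem_range.1 hb.2.2
  obtain ⟨h0, ha, hsum, hbx⟩ := cfg.hypotheses_of_feasible hb hx
  have h23 := inv_factorial_le_sum_prod cfg hJ x.1 (fun p i => x.1 p + x.2 (cfg.lineAt p i)) h0
    (fun p hp p' hp' i i' hline _ => ha p hp p' hp' i i' hline) hsum
  have hpos : (0 : ℝ) < ∑ p ∈ cfg.J, ∏ i, (x.1 p + x.2 (cfg.lineAt p i)) :=
    lt_of_lt_of_le (by positivity) h23
  obtain ⟨p, hp, hprod⟩ : ∃ p ∈ cfg.J, 0 < ∏ i, (x.1 p + x.2 (cfg.lineAt p i)) := by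
    by_contra! hle
    exact absurd (Finset.sum_nonpos hle) (not_le.2 hpos)
  refine hprod.trans_le ?_
  have := cfg.prod_le_maxProd hJ b ⟨p, hp⟩
  simp only [hbx p hp] at this
  exact this

/-- **The perturbation step of Lemma 2.4.** If a feasible `b` has a maximising joint and a
non-maximising joint on a common line, then lowering `a_p` by a small `ε > 0` at the maximising
joints (and raising `λ_ℓ` so that the line sums stay `1`) produces a feasible `b′` whose products
are all `≤ W = max_p ∏ b_p`, with strictly fewer joints attaining `W`.
[cite: YuZhao2023JointsTightened, Lemma 2.4 (proof; arXiv v2, pp. 4–5)] -/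
theorem exists_fewer_maximisers (hJ : cfg.J.Nonempty) {b₀ : ↥cfg.J × Fin d → ℝ}
    (hb₀ : b₀ ∈ cfg.feasible) {pM pN : ↥cfg.J}
    (hpM : ∏ i, b₀ (pM, i) = cfg.maxProd hJ b₀) (hpN : ∏ i, b₀ (pN, i) ≠ cfg.maxProd hJ b₀)
    {i₁ i₂ : Fin d} (hline : cfg.lineAt pM i₁ = cfg.lineAt pN i₂) :
    ∃ b ∈ cfg.feasible, cfg.maxProd hJ b ≤ cfg.maxProd hJ b₀ ∧
      ((univ : Finset ↥cfg.J).filter fun p => ∏ i, b (p, i) = cfg.maxProd hJ b₀).card <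
        ((univ : Finset ↥cfg.J).filter fun p => ∏ i, b₀ (p, i) = cfg.maxProd hJ b₀).card := by
  classical
  set W := cfg.maxProd hJ b₀ with hW
  have hWpos : 0 < W := cfg.maxProd_pos hJ hb₀
  set M := (univ : Finset ↥cfg.J).filter fun p => ∏ i, b₀ (p, i) = W with hM
  have hmemM : ∀ p, p ∈ M ↔ ∏ i, b₀ (p, i) = W := fun p => by simp [hM]
  have hpMM : pM ∈ M := (hmemM pM).2 hpM
  have hpNM : pN ∉ M := fun h => hpN ((hmemM pN).1 h)
  have hltW : ∀ p, p ∉ M → ∏ i, b₀ (p, i) < W := fun p hp =>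
    lt_of_le_of_ne (cfg.prod_le_maxProd hJ b₀ p) (fun h => hp ((hmemM p).2 h))
  have hposM : ∀ p ∈ M, ∀ i, 0 < b₀ (p, i) := by
    intro p hp i
    rcases (hb₀.1 (p, i)).eq_or_lt with h | h
    · exfalso
      have h0 : ∏ j, b₀ (p, j) = 0 := Finset.prod_eq_zero (mem_univ i) h.symm
      rw [(hmemM p).1 hp] at h0
      exact hWpos.ne' h0
    · exact h
  obtain ⟨x₀, hx₀⟩ := LinearMap.mem_range.1 hb₀.2.2
  have hb₀q : ∀ q, b₀ q = x₀.1 q.1 + x₀.2 (cfg.incLine q) := fun q => by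
    rw [← hx₀, weightMap_apply]
  -- counts of (maximising) incidences on each line
  set S : Finset (Fin d → F) := M.map (Function.Embedding.subtype _) with hS
  have hmemS : ∀ p : ↥cfg.J, (p : Fin d → F) ∈ S ↔ p ∈ M := by
    intro p
    rw [hS, Finset.mem_map]
    constructor
    · rintro ⟨p', hp', h⟩
      rwa [← Subtype.ext h]
    · intro hp
      exact ⟨p, hp, rfl⟩
  set kM : Set (Fin d → F) → ℝ := fun ℓ => (((cfg.incOn ℓ).filter fun q => q.1 ∈ M).card : ℝ)
    with hkM
  set N : Set (Fin d → F) → ℝ := fun ℓ => ((cfg.incOn ℓ).card : ℝ) with hNdef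
  have hkN : ∀ ℓ, kM ℓ ≤ N ℓ := fun ℓ => by
    simp only [hkM, hNdef]
    exact_mod_cast Finset.card_filter_le _ _
  have hk0 : ∀ ℓ, 0 ≤ kM ℓ := fun ℓ => by positivity
  have hNq : ∀ q, 0 < N (cfg.incLine q) := fun q => by
    simp only [hNdef]
    exact_mod_cast cfg.card_incOn_pos (cfg.incLine_mem_lines q)
  have hkN₀ : kM (cfg.incLine (pM, i₁)) < N (cfg.incLine (pM, i₁)) := by
    simp only [hkM, hNdef]
    have hmem : (pN, i₂) ∈ cfg.incOn (cfg.incLine (pM, i₁)) :=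
      cfg.mem_incOn_iff.2 (by rw [incLine_eq, incLine_eq]; exact hline.symm)
    exact_mod_cast Finset.card_lt_card (Finset.filter_ssubset.2 ⟨(pN, i₂), hmem, hpNM⟩)
  -- the perturbation direction `c_q = k_ℓ / N_ℓ − [p ∈ M]`
  set ind : (Fin d → F) → ℝ := fun p => if p ∈ S then 1 else 0 with hind
  have hind1 : ∀ q : ↥cfg.J × Fin d, q.1 ∈ M → ind q.1 = 1 := fun q hq => by
    simp only [hind, if_pos ((hmemS q.1).2 hq)]
  have hind0 : ∀ q : ↥cfg.J × Fin d, q.1 ∉ M → ind q.1 = 0 := fun q hq => by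
    simp only [hind]
    rw [if_neg (fun h => hq ((hmemS q.1).1 h))]
  set c : ↥cfg.J × Fin d → ℝ := fun q => kM (cfg.incLine q) / N (cfg.incLine q) - ind q.1 with hc
  have hcM : ∀ q : ↥cfg.J × Fin d, q.1 ∈ M → c q ≤ 0 ∧ -1 ≤ c q := fun q hq => by
    simp only [hc, hind1 q hq]
    constructor
    · have := div_le_one_of_le₀ (hkN (cfg.incLine q)) (hNq q).le
      linarith
    · have : 0 ≤ kM (cfg.incLine q) / N (cfg.incLine q) := div_nonneg (hk0 _) (hNq q).le
      linarith
  have hcN : ∀ q : ↥cfg.J × Fin d, q.1 ∉ M → 0 ≤ c q := fun q hq => by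
    simp only [hc, hind0 q hq, sub_zero]
    exact div_nonneg (hk0 _) (hNq q).le
  have hc₀ : c (pM, i₁) < 0 := by
    simp only [hc, hind1 (pM, i₁) hpMM]
    have := (div_lt_one (hNq (pM, i₁))).2 hkN₀
    linarith
  set xε : ℝ → ((Fin d → F) → ℝ) × (Set (Fin d → F) → ℝ) := fun ε =>
    (fun p => x₀.1 p - ε * ind p, fun ℓ => x₀.2 ℓ + ε * (kM ℓ / N ℓ)) with hxε
  have hbε : ∀ ε q, cfg.weightMap (xε ε) q = b₀ q + ε * c q := by
    intro ε q
    rw [weightMap_apply, hb₀q]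
    simp only [hxε, hc]
    ring
  -- line sums are preserved
  have hsumε : ∀ ε, ∀ ℓ ∈ cfg.lines, ∑ q ∈ cfg.incOn ℓ, cfg.weightMap (xε ε) q = 1 := by
    intro ε ℓ hℓ
    simp_rw [hbε]
    rw [Finset.sum_add_distrib, hb₀.2.1 ℓ hℓ, ← Finset.mul_sum]
    suffices h : ∑ q ∈ cfg.incOn ℓ, c q = 0 by rw [h, mul_zero, add_zero]
    simp only [hc]
    rw [Finset.sum_sub_distrib, Finset.sum_congr rfl fun q hq => by rw [cfg.mem_incOn_iff.1 hq],
      Finset.sum_const, nsmul_eq_mul]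
    have hindsum : ∑ q ∈ cfg.incOn ℓ, ind q.1 = kM ℓ := by
      simp only [hind, hkM]
      rw [Finset.sum_boole]
      congr 2
      ext q
      simp only [Finset.mem_filter, hmemS]
    rw [hindsum]
    have hN0 : N ℓ ≠ 0 := by
      have := cfg.card_incOn_pos hℓ
      simp only [hNdef]
      positivity
    rw [mul_comm, div_mul_cancel₀ _ hN0, sub_self]
  -- choice of `ε`
  have hE2 : ∀ᶠ ε in 𝓝 (0 : ℝ), ∀ q ∈ (univ : Finset (↥cfg.J × Fin d)).filter (fun q => q.1 ∈ M),
      ε ≤ b₀ q := by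
    refine (Finset.eventually_all _).2 fun q hq => eventually_le_nhds ?_
    exact hposM q.1 (Finset.mem_filter.1 hq).2 q.2
  have hE3 : ∀ᶠ ε in 𝓝 (0 : ℝ), ∀ p ∈ (univ : Finset ↥cfg.J).filter (fun p => p ∉ M),
      ∏ i, (b₀ (p, i) + ε * c (p, i)) < W := by
    refine (Finset.eventually_all _).2 fun p hp => ?_
    have hcont : Continuous fun ε : ℝ => ∏ i, (b₀ (p, i) + ε * c (p, i)) :=
      continuous_finsetProd _ fun i _ => continuous_const.add (continuous_id.mul continuous_const)
    have h0 : ∏ i, (b₀ (p, i) + 0 * c (p, i)) < W := by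
      simpa using hltW p (Finset.mem_filter.1 hp).2
    exact (hcont.tendsto 0).eventually_lt_const h0
  have hE1 : ∀ᶠ ε in 𝓝[>] (0 : ℝ), 0 < ε := eventually_mem_nhdsWithin
  obtain ⟨ε, hεpos, hε2, hε3⟩ :=
    (hE1.and ((hE2.and hE3).filter_mono nhdsWithin_le_nhds)).exists
  -- the perturbed weights are feasible
  have hnonneg : ∀ q, 0 ≤ cfg.weightMap (xε ε) q := by
    intro q
    rw [hbε]
    by_cases hq : q.1 ∈ M
    · have h1 := hε2 q (Finset.mem_filter.2 ⟨mem_univ _, hq⟩)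
      have h2 := (hcM q hq).2
      nlinarith
    · have := hcN q hq
      have := hb₀.1 q
      positivity
  have hbεB : cfg.weightMap (xε ε) ∈ cfg.feasible :=
    ⟨hnonneg, hsumε ε, LinearMap.mem_range_self _ _⟩
  -- products: `≤ W` at maximisers, `< W` at `pM` and at non-maximisers
  have hleM : ∀ p ∈ M, ∏ i, cfg.weightMap (xε ε) (p, i) ≤ W := by
    intro p hp
    rw [← (hmemM p).1 hp]
    refine Finset.prod_le_prod (fun i _ => hnonneg _) fun i _ => ?_
    rw [hbε]
    have := (hcM (p, i) hp).1
    nlinarith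
  have hltM : ∏ i, cfg.weightMap (xε ε) (pM, i) < W := by
    by_cases hz : ∃ i, cfg.weightMap (xε ε) (pM, i) = 0
    · obtain ⟨i, hi⟩ := hz
      rw [Finset.prod_eq_zero (mem_univ i) hi]
      exact hWpos
    · push Not at hz
      rw [← (hmemM pM).1 hpMM]
      refine Finset.prod_lt_prod (fun i _ => lt_of_le_of_ne (hnonneg _) (hz i).symm)
        (fun i _ => ?_) ⟨i₁, mem_univ _, ?_⟩
      · rw [hbε]
        have := (hcM (pM, i) hpMM).1
        nlinarith
      · rw [hbε]
        nlinarith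
  have hltN : ∀ p, p ∉ M → ∏ i, cfg.weightMap (xε ε) (p, i) < W := by
    intro p hp
    simp_rw [hbε]
    exact hε3 p (Finset.mem_filter.2 ⟨mem_univ _, hp⟩)
  refine ⟨cfg.weightMap (xε ε), hbεB, Finset.sup'_le _ _ fun p _ => ?_, ?_⟩
  · by_cases hp : p ∈ M
    · exact hleM p hp
    · exact (hltN p hp).le
  · have hsub : ((univ : Finset ↥cfg.J).filter fun p => ∏ i, cfg.weightMap (xε ε) (p, i) = W) ⊆
        M.erase pM := by
      intro p hp
      have hpW : ∏ i, cfg.weightMap (xε ε) (p, i) = W := (Finset.mem_filter.1 hp).2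
      refine Finset.mem_erase.2 ⟨?_, ?_⟩
      · rintro rfl
        exact hltM.ne hpW
      · by_contra hpM'
        exact (hltN p hpM').ne hpW
    calc _ ≤ (M.erase pM).card := Finset.card_le_card hsub
      _ < M.card := Finset.card_erase_lt_of_mem hpMM

/-- **Lemma 2.4 (Yu–Zhao).** "Let `(𝓙, 𝓛)` be a connected joints configuration in `𝔽^d`. Then
there exist real numbers `a_p, b_{p,ℓ}` satisfying the hypothesis of Lemma 2.3 with an additional
constraint that `∏_{ℓ ∋ p} b_{p,ℓ}` has the same value for all `p ∈ 𝓙`."  (The weights produced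
satisfy (a) for all pairs of incidences of a line, not only when `b_{p′,ℓ} > 0`; `𝓙 ≠ ∅` is
part of the hypotheses.)  Proof as printed: minimise `max_p ∏_{ℓ ∋ p} b_{p,ℓ}` over the compact
feasible set (`isCompact_feasible`), then the number of maximising joints; by connectivity and
`exists_fewer_maximisers` every joint is maximising.
[cite: YuZhao2023JointsTightened, Lemma 2.4 (§2; arXiv v2, p. 4)] -/
theorem exists_weights_prod_eq (hJ : cfg.J.Nonempty) (hconn : cfg.IsConnected) :
    ∃ (a : (Fin d → F) → ℝ) (b : (Fin d → F) → Fin d → ℝ) (W : ℝ),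
      (∀ p ∈ cfg.J, ∀ i, 0 ≤ b p i) ∧
      (∀ p ∈ cfg.J, ∀ p' ∈ cfg.J, ∀ i i', cfg.lineAt p i = cfg.lineAt p' i' →
        b p i - a p = b p' i' - a p') ∧
      (∀ ℓ ∈ cfg.lines, ∑ q ∈ cfg.onLine ℓ, b q.1 q.2 = 1) ∧
      (∀ p ∈ cfg.J, ∏ i, b p i = W) := by
  classical
  -- Step 1: minimise the objective on the feasible set
  obtain ⟨b₁, hb₁B, hmin₁⟩ := cfg.isCompact_feasible.exists_isMinOn cfg.feasible_nonempty
    (cfg.continuous_maxProd hJ).continuousOn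
  set W := cfg.maxProd hJ b₁ with hW
  have hWmin : ∀ b ∈ cfg.feasible, W ≤ cfg.maxProd hJ b := fun b hb => hmin₁ hb
  -- Step 2: among the minimisers, minimise the number of maximising joints
  have hex : ∃ m, ∃ b ∈ cfg.feasible, cfg.maxProd hJ b = W ∧
      ((univ : Finset ↥cfg.J).filter fun p => ∏ i, b (p, i) = W).card = m :=
    ⟨_, b₁, hb₁B, rfl, rfl⟩
  obtain ⟨b₀, hb₀B, hΦb₀, hcard₀⟩ := Nat.find_spec hex
  -- Step 3: every joint is maximising
  set M := (univ : Finset ↥cfg.J).filter fun p => ∏ i, b₀ (p, i) = W with hM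
  have hmin₀ : ∀ b ∈ cfg.feasible, cfg.maxProd hJ b = W →
      M.card ≤ ((univ : Finset ↥cfg.J).filter fun p => ∏ i, b (p, i) = W).card := by
    intro b hb hΦb
    have h1 : M.card = Nat.find hex := hcard₀
    rw [h1]
    exact Nat.find_min' hex ⟨b, hb, hΦb, rfl⟩
  have hmemM : ∀ p, p ∈ M ↔ ∏ i, b₀ (p, i) = W := fun p => by simp [hM]
  have hall : M = univ := by
    by_contra hMne
    obtain ⟨pmax, hpmax⟩ := cfg.exists_prod_eq_maxProd hJ b₀
    have hpmaxM : pmax ∈ M := (hmemM pmax).2 (hpmax.trans hΦb₀)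
    -- connectivity: a maximising joint shares a line with a non-maximising joint
    set S : Finset (Fin d → F) := M.map (Function.Embedding.subtype _) with hS
    have hmemS : ∀ p : ↥cfg.J, (p : Fin d → F) ∈ S ↔ p ∈ M := by
      intro p
      rw [hS, Finset.mem_map]
      constructor
      · rintro ⟨p', hp', h⟩
        rwa [← Subtype.ext h]
      · intro hp
        exact ⟨p, hp, rfl⟩
    have hSsub : S ⊆ cfg.J := by
      intro x hx
      obtain ⟨p', -, rfl⟩ := Finset.mem_map.1 hx
      exact p'.2
    have hSneJ : S ≠ cfg.J := by
      intro hSJ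
      apply hMne
      refine Finset.eq_univ_of_forall fun p => (hmemS p).1 ?_
      rw [hSJ]
      exact p.2
    obtain ⟨p₁, hp₁S, p₂, hp₂J, hp₂S, i₁, i₂, hline⟩ :=
      hconn S hSsub ⟨pmax, (hmemS pmax).2 hpmaxM⟩ hSneJ
    have hpMM : (⟨p₁, hSsub hp₁S⟩ : ↥cfg.J) ∈ M := (hmemS _).1 hp₁S
    have hpNM : (⟨p₂, hp₂J⟩ : ↥cfg.J) ∉ M := fun h => hp₂S ((hmemS _).2 h)
    obtain ⟨b, hbB, hle, hlt⟩ := cfg.exists_fewer_maximisers hJ hb₀B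
      (((hmemM _).1 hpMM).trans hΦb₀.symm) (fun h => hpNM ((hmemM _).2 (h.trans hΦb₀))) hline
    rw [hΦb₀] at hle hlt
    have hcard := hmin₀ b hbB (le_antisymm hle (hWmin b hbB))
    have hlt' : ((univ : Finset ↥cfg.J).filter fun p => ∏ i, b (p, i) = W).card < M.card := hlt
    omega
  -- Step 4: read off the weights
  obtain ⟨x₀, hx₀⟩ := LinearMap.mem_range.1 hb₀B.2.2
  obtain ⟨h0, ha, hsum, hbx⟩ := cfg.hypotheses_of_feasible hb₀B hx₀
  refine ⟨x₀.1, fun p i => x₀.1 p + x₀.2 (cfg.lineAt p i), W, h0, ha, hsum, fun p hp => ?_⟩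
  have hp' : (⟨p, hp⟩ : ↥cfg.J) ∈ M := hall ▸ mem_univ _
  have := (hmemM _).1 hp'
  simp only [hbx p hp] at this
  exact this

end Variational

end JointsConfig

end Connected

/-! ### Theorem 1.3: the sharp bound -/
section Main

open Real

namespace JointsConfig

/-- The sub-configuration on a subset of the joints (same frames). [folklore] -/
def restrict (cfg : JointsConfig F d) (S : Finset (Fin d → F)) (hS : S ⊆ cfg.J) :
    JointsConfig F d :=
  ⟨S, cfg.e, fun p hp => cfg.linearIndependent p (hS hp)⟩

/-- The lines of a sub-configuration are lines of the configuration. [folklore] -/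
private theorem lines_restrict_subset (cfg : JointsConfig F d) (S : Finset (Fin d → F))
    (hS : S ⊆ cfg.J) :
    (cfg.restrict S hS).lines ⊆ cfg.lines := by
  intro ℓ hℓ
  obtain ⟨p, hp, i, rfl⟩ := (cfg.restrict S hS).mem_lines_iff.1 hℓ
  exact cfg.mem_lines_iff.2 ⟨p, hS hp, i, rfl⟩

/-- **`∑_p ∑_{ℓ ∋ p} b_{p,ℓ} = ∑_ℓ ∑_{p ∈ ℓ} b_{p,ℓ}`**: summing weights over joints then chosen
lines is summing over lines then incidences.
[cite: YuZhao2023JointsTightened, Theorem 1.3 (proof; arXiv v2, p. 5)] -/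
theorem sum_sum_eq_sum_lines (cfg : JointsConfig F d) (b : (Fin d → F) → Fin d → ℝ) :
    ∑ p ∈ cfg.J, ∑ i, b p i = ∑ ℓ ∈ cfg.lines, ∑ q ∈ cfg.onLine ℓ, b q.1 q.2 := by
  classical
  rw [← Finset.sum_product (cfg.J) univ (fun q => b q.1 q.2),
    ← Finset.sum_fiberwise_of_maps_to (g := fun q => cfg.lineAt q.1 q.2) (t := cfg.lines)
      (fun q hq => cfg.lineAt_mem_lines (Finset.mem_product.1 hq).1 q.2)]
  rfl

/-- **Proof of Theorem 1.3, connected case** ("By the AM–GM inequality followed by hypothesis (b)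
in Lemma 2.3, `d J W^{1/d} ≤ L`, and thus `W ≤ L^d/(d^d J^d)`. Thus, by Lemma 2.3,
`1/d! ≤ J W ≤ L^d/(d^d J^{d−1})`"): for a connected nonempty configuration with `J` joints and
`L` chosen lines, `J^{d−1} d^{d−1} ≤ (d−1)! L^d`.
[cite: YuZhao2023JointsTightened, Theorem 1.3 (proof, §2; arXiv v2, p. 5)] -/
theorem card_pow_mul_pow_le_of_isConnected (cfg : JointsConfig F d) (hJ : cfg.J.Nonempty)
    (hconn : cfg.IsConnected) (hd : 1 ≤ d) :
    (cfg.J.card : ℝ) ^ (d - 1) * (d : ℝ) ^ (d - 1) ≤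
      ((d - 1).factorial : ℝ) * (cfg.lines.card : ℝ) ^ d := by
  obtain ⟨a, b, W, hb0, ha, hb, hW⟩ := cfg.exists_weights_prod_eq hJ hconn
  set J := (cfg.J.card : ℝ) with hJdef
  set L := (cfg.lines.card : ℝ) with hLdef
  have hJpos : 0 < J := by simp only [hJdef]; exact_mod_cast hJ.card_pos
  have hdR : (0 : ℝ) < d := by exact_mod_cast hd
  -- Lemma 2.3: `1/d! ≤ ∑_p ∏ b = J W`
  have h23 : (1 : ℝ) / d.factorial ≤ J * W := by
    have h := inv_factorial_le_sum_prod cfg hJ a b hb0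
      (fun p hp p' hp' i i' hline _ => ha p hp p' hp' i i' hline) hb
    rwa [Finset.sum_congr rfl fun p hp => hW p hp, Finset.sum_const, nsmul_eq_mul] at h
  have hWpos : 0 < W := by
    have : 0 < J * W := lt_of_lt_of_le (by positivity) h23
    by_contra hle
    push Not at hle
    nlinarith
  -- AM–GM at each joint: `d W^{1/d} ≤ ∑_i b_{p,i}`
  have hAM : ∀ p ∈ cfg.J, (d : ℝ) * W ^ ((1 : ℝ) / d) ≤ ∑ i, b p i := by
    intro p hp
    have h := Real.geom_mean_le_arith_mean_weighted (univ : Finset (Fin d)) (fun _ => (1 : ℝ) / d)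
      (b p) (fun _ _ => by positivity)
      (by rw [Finset.sum_const, Finset.card_univ, Fintype.card_fin, nsmul_eq_mul]; field_simp)
      (fun i _ => hb0 p hp i)
    rw [Real.finsetProd_rpow _ _ (fun i _ => hb0 p hp i), hW p hp, ← Finset.mul_sum] at h
    calc (d : ℝ) * W ^ ((1 : ℝ) / d) ≤ d * ((1 / d) * ∑ i, b p i) :=
          mul_le_mul_of_nonneg_left h hdR.le
      _ = ∑ i, b p i := by field_simp
  -- summing over the joints and using (b): `J d W^{1/d} ≤ L`
  have hsum : J * ((d : ℝ) * W ^ ((1 : ℝ) / d)) ≤ L := by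
    calc J * ((d : ℝ) * W ^ ((1 : ℝ) / d)) = ∑ _p ∈ cfg.J, (d : ℝ) * W ^ ((1 : ℝ) / d) := by
          rw [Finset.sum_const, nsmul_eq_mul]
      _ ≤ ∑ p ∈ cfg.J, ∑ i, b p i := Finset.sum_le_sum hAM
      _ = ∑ ℓ ∈ cfg.lines, ∑ q ∈ cfg.onLine ℓ, b q.1 q.2 := cfg.sum_sum_eq_sum_lines b
      _ = ∑ _ℓ ∈ cfg.lines, (1 : ℝ) := Finset.sum_congr rfl hb
      _ = L := by rw [Finset.sum_const, nsmul_eq_mul, mul_one]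
  -- `W ≤ (L/(dJ))^d` and `1/d! ≤ J W`
  have hs : (W ^ ((1 : ℝ) / d)) ^ d = W := by
    rw [one_div]
    exact Real.rpow_inv_natCast_pow hWpos.le (by omega)
  have h1 : (J * ((d : ℝ) * W ^ ((1 : ℝ) / d))) ^ d ≤ L ^ d :=
    pow_le_pow_left₀ (by positivity) hsum d
  rw [mul_pow, mul_pow, hs] at h1
  have h3 : 1 ≤ (d.factorial : ℝ) * (J * W) := by
    have := mul_le_mul_of_nonneg_left h23 (show (0 : ℝ) ≤ d.factorial by positivity)
    rwa [mul_one_div_cancel (by positivity)] at this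
  obtain ⟨k, rfl⟩ : ∃ k, d = k + 1 := ⟨d - 1, by omega⟩
  simp only [Nat.add_sub_cancel]
  rw [Nat.factorial_succ] at h3
  push_cast at h1 h3 ⊢
  calc J ^ k * ((k : ℝ) + 1) ^ k
      ≤ J ^ k * ((k : ℝ) + 1) ^ k * (((k : ℝ) + 1) * k.factorial * (J * W)) :=
        le_mul_of_one_le_right (by positivity) h3
    _ = k.factorial * (J ^ (k + 1) * (((k : ℝ) + 1) ^ (k + 1) * W)) := by ring
    _ ≤ k.factorial * L ^ (k + 1) := mul_le_mul_of_nonneg_left h1 (by positivity)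

/-- **Theorem 1.3 (Yu–Zhao) for joints configurations:** a configuration in `𝔽^d`, `d ≥ 2`, with
`L` chosen lines has at most `((d−1)!)^{1/(d−1)}/d · L^{d/(d−1)}` joints.  ("Finally, decompose
`(𝓙, 𝓛)` into connected components … and apply the above result individually to each component
to obtain `|𝓙| = ∑ᵢ |𝓙ᵢ| ≤ C_d ∑ᵢ |𝓛ᵢ|^{d/(d−1)} ≤ C_d |𝓛|^{d/(d−1)}`"; here by induction on the
number of joints, splitting off a union of components.)
[cite: YuZhao2023JointsTightened, Theorem 1.3 (proof, §2; arXiv v2, p. 5)] -/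
theorem card_le_rpow (hd : 2 ≤ d) (cfg : JointsConfig F d) :
    (cfg.J.card : ℝ) ≤ ((d - 1).factorial : ℝ) ^ ((1 : ℝ) / (d - 1)) / d *
      (cfg.lines.card : ℝ) ^ ((d : ℝ) / (d - 1)) := by
  classical
  suffices h : ∀ (n : ℕ) (cfg : JointsConfig F d), cfg.J.card = n →
      (cfg.J.card : ℝ) ≤ ((d - 1).factorial : ℝ) ^ ((1 : ℝ) / (d - 1)) / d *
        (cfg.lines.card : ℝ) ^ ((d : ℝ) / (d - 1)) from h _ cfg rfl
  intro n
  induction n using Nat.strong_induction_on with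
  | _ n ih =>
    intro cfg hn
    have hdR : (2 : ℝ) ≤ d := by exact_mod_cast hd
    have hd1 : (0 : ℝ) < (d : ℝ) - 1 := by linarith
    have hC0 : 0 ≤ ((d - 1).factorial : ℝ) ^ ((1 : ℝ) / (d - 1)) / d := by positivity
    have hr0 : 0 ≤ (d : ℝ) / (d - 1) := div_nonneg (by positivity) hd1.le
    have hr1 : 1 ≤ (d : ℝ) / (d - 1) := by
      rw [le_div_iff₀ hd1]
      linarith
    rcases cfg.J.eq_empty_or_nonempty with hJ | hJ
    · rw [hJ, Finset.card_empty, Nat.cast_zero]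
      positivity
    by_cases hconn : cfg.IsConnected
    · -- a connected configuration: take `(d − 1)`-th roots in the power form
      have hpow := cfg.card_pow_mul_pow_le_of_isConnected hJ hconn (by omega)
      have hJ0 : (0 : ℝ) ≤ cfg.J.card := Nat.cast_nonneg _
      have hL0 : (0 : ℝ) ≤ cfg.lines.card := Nat.cast_nonneg _
      have hd1' : (d - 1 : ℕ) ≠ 0 := by omega
      have h' : ((cfg.J.card : ℝ) * d) ^ (d - 1) ≤
          ((d - 1).factorial : ℝ) * (cfg.lines.card : ℝ) ^ d := by
        rw [mul_pow]; exact hpow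
      have key := Real.rpow_le_rpow (by positivity) h'
        (show (0 : ℝ) ≤ ((d - 1 : ℕ) : ℝ)⁻¹ by positivity)
      rw [Real.pow_rpow_inv_natCast (by positivity) hd1',
        Real.mul_rpow (by positivity) (pow_nonneg hL0 _),
        ← Real.rpow_natCast (cfg.lines.card : ℝ) d, ← Real.rpow_mul hL0] at key
      have hexp : ((1 : ℝ) / (d - 1)) = ((d - 1 : ℕ) : ℝ)⁻¹ := by
        rw [Nat.cast_sub (by omega), Nat.cast_one, one_div]
      have hexp' : (d : ℝ) / (d - 1) = (d : ℝ) * ((d - 1 : ℕ) : ℝ)⁻¹ := by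
        rw [Nat.cast_sub (by omega), Nat.cast_one, div_eq_mul_inv]
      rw [hexp, hexp', div_mul_eq_mul_div, le_div_iff₀ (by positivity)]
      exact key
    · -- a disconnected configuration splits into two with disjoint sets of lines
      unfold IsConnected at hconn
      push Not at hconn
      obtain ⟨S, hSJ, hSne, hSneJ, hnoX⟩ := hconn
      set cfg₁ := cfg.restrict S hSJ with hcfg₁
      set cfg₂ := cfg.restrict (cfg.J \ S) Finset.sdiff_subset with hcfg₂
      have hcard : cfg.J.card = S.card + (cfg.J \ S).card := by
        rw [add_comm, Finset.card_sdiff_add_card_eq_card hSJ]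
      have hlt₁ : S.card < n :=
        hn ▸ Finset.card_lt_card (Finset.ssubset_iff_subset_ne.2 ⟨hSJ, hSneJ⟩)
      have hlt₂ : (cfg.J \ S).card < n := by
        have := hSne.card_pos
        omega
      have ih₁ := ih _ hlt₁ cfg₁ rfl
      have ih₂ := ih _ hlt₂ cfg₂ rfl
      have hdisj : Disjoint cfg₁.lines cfg₂.lines := by
        rw [Finset.disjoint_left]
        intro ℓ h₁ h₂
        obtain ⟨p, hp, i, rfl⟩ := cfg₁.mem_lines_iff.1 h₁
        obtain ⟨p', hp', i', h⟩ := cfg₂.mem_lines_iff.1 h₂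
        exact hnoX p hp p' (Finset.mem_sdiff.1 hp').1 (Finset.mem_sdiff.1 hp').2 i i' h.symm
      have hLle : (cfg₁.lines.card : ℝ) + cfg₂.lines.card ≤ cfg.lines.card := by
        have hsub : cfg₁.lines ∪ cfg₂.lines ⊆ cfg.lines :=
          Finset.union_subset (cfg.lines_restrict_subset S hSJ)
            (cfg.lines_restrict_subset (cfg.J \ S) Finset.sdiff_subset)
        have := Finset.card_le_card hsub
        rw [Finset.card_union_of_disjoint hdisj] at this
        exact_mod_cast this
      set C := ((d - 1).factorial : ℝ) ^ ((1 : ℝ) / (d - 1)) / d with hC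
      set r := (d : ℝ) / (d - 1) with hr
      calc (cfg.J.card : ℝ) = cfg₁.J.card + cfg₂.J.card := by
            rw [hcard]; push_cast; rfl
        _ ≤ C * (cfg₁.lines.card : ℝ) ^ r + C * (cfg₂.lines.card : ℝ) ^ r := add_le_add ih₁ ih₂
        _ = C * ((cfg₁.lines.card : ℝ) ^ r + (cfg₂.lines.card : ℝ) ^ r) := by ring
        _ ≤ C * (((cfg₁.lines.card : ℝ) + cfg₂.lines.card) ^ r) :=
            mul_le_mul_of_nonneg_left
              (Real.add_rpow_le_rpow_add (Nat.cast_nonneg _) (Nat.cast_nonneg _) hr1) hC0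
        _ ≤ C * (cfg.lines.card : ℝ) ^ r :=
            mul_le_mul_of_nonneg_left (Real.rpow_le_rpow (by positivity) hLle hr0) hC0

end JointsConfig

/-- **Theorem 1.3 (Yu–Zhao, main theorem).** "The number of joints formed by `L` lines in `𝔽^d`
is at most `((d−1)!)^{1/(d−1)}/d · L^{d/(d−1)}`."  For every field `F`, every `d ≥ 2` and every
finite family `L` (of lines; members of `L` that are not lines are never among the `d` lines at a
joint, so they only weaken the bound), with `joints L` the set of joints of
`JointsProblem.lean` (`IsJoint`: `d` lines of `L` through `p` with linearly independent
directions, equivalently not all in one hyperplane, `isJoint_iff`).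
[cite: YuZhao2023JointsTightened, Theorem 1.3 (§1; arXiv v2, p. 1)] -/
theorem ncard_joints_le_tight (hd : 2 ≤ d) (L : Finset (Set (Fin d → F))) :
    ((joints L).ncard : ℝ) ≤ ((d - 1).factorial : ℝ) ^ ((1 : ℝ) / (d - 1)) / d *
      (L.card : ℝ) ^ ((d : ℝ) / (d - 1)) := by
  classical
  have hfin := joints_finite hd L
  have hframe : ∀ p ∈ hfin.toFinset, ∃ v : Matrix (Fin d) (Fin d) F,
      LinearIndependent F (fun i => v i) ∧ ∀ i, line F p (v i) ∈ L := by
    intro p hp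
    obtain ⟨v, hv, hL⟩ := (hfin.mem_toFinset.1 hp : IsJoint L p)
    exact ⟨v, hv, hL⟩
  choose! e he hL using hframe
  set cfg : JointsConfig F d := ⟨hfin.toFinset, e, fun p hp => he p hp⟩ with hcfg
  have hlines : cfg.lines ⊆ L := by
    intro ℓ hℓ
    obtain ⟨p, hp, i, rfl⟩ := cfg.mem_lines_iff.1 hℓ
    exact hL p hp i
  have hJ : (joints L).ncard = cfg.J.card := by
    rw [Set.ncard_eq_toFinset_card _ hfin]
  rw [hJ]
  have hdR : (2 : ℝ) ≤ d := by exact_mod_cast hd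
  refine (cfg.card_le_rpow hd).trans (mul_le_mul_of_nonneg_left (Real.rpow_le_rpow
    (Nat.cast_nonneg _) (by exact_mod_cast Finset.card_le_card hlines)
    (div_nonneg (by positivity) (by linarith))) (by positivity))

/-- **Theorem 1.3 in integer form:** `|joints L|^{d−1} · d^{d−1} ≤ (d−1)! · |L|^d` — the printed
bound raised to the power `d − 1` (compare `ncard_joints_pow_le`: `|joints L|^{d−1} ≤ d! |L|^d`,
weaker by the factor `d^d`). [cite: YuZhao2023JointsTightened, Theorem 1.3 (§1; arXiv v2, p. 1)] -/
theorem ncard_joints_pow_mul_pow_le (hd : 2 ≤ d) (L : Finset (Set (Fin d → F))) :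
    (joints L).ncard ^ (d - 1) * d ^ (d - 1) ≤ (d - 1).factorial * L.card ^ d := by
  have h := ncard_joints_le_tight hd L
  have hdR : (2 : ℝ) ≤ d := by exact_mod_cast hd
  have hd1 : (0 : ℝ) < (d : ℝ) - 1 := by linarith
  have hd1' : (d - 1 : ℕ) ≠ 0 := by omega
  have hL0 : (0 : ℝ) ≤ L.card := Nat.cast_nonneg _
  -- `J d ≤ ((d−1)!)^{1/(d−1)} L^{d/(d−1)}`, then raise to the power `d − 1`
  rw [div_mul_eq_mul_div, le_div_iff₀ (by positivity)] at h
  have key := pow_le_pow_left₀ (by positivity) h (d - 1)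
  have hexp : ((1 : ℝ) / (d - 1)) = ((d - 1 : ℕ) : ℝ)⁻¹ := by
    rw [Nat.cast_sub (by omega), Nat.cast_one, one_div]
  rw [mul_pow, mul_pow, hexp, Real.rpow_inv_natCast_pow (by positivity) hd1',
    ← Real.rpow_natCast ((L.card : ℝ) ^ ((d : ℝ) / (d - 1))) (d - 1), ← Real.rpow_mul hL0,
    Nat.cast_sub (by omega), Nat.cast_one, div_mul_cancel₀ _ hd1.ne', Real.rpow_natCast] at key
  exact_mod_cast key

end Main

/-! ### The Remark after Lemma 2.2: Guth's conjectured optimum under equal joint counts -/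
section EqualCounts

namespace JointsConfig

/-- **Double counting the incidences:** `∑_{ℓ ∈ 𝓛} #{p : p ∈ ℓ} = d |𝓙|` (each joint lies on its
`d` chosen lines). [cite: YuZhao2023JointsTightened, Remark after Lemma 2.2 (§2; arXiv v2, p. 4:
"`C(d|𝓙|/|𝓛| + d − 1, d)`")] -/
theorem sum_card_onLine (cfg : JointsConfig F d) :
    ∑ ℓ ∈ cfg.lines, (cfg.onLine ℓ).card = cfg.J.card * d := by
  classical
  have h : (cfg.J ×ˢ (univ : Finset (Fin d))).card = cfg.J.card * d := by
    rw [Finset.card_product, Finset.card_univ, Fintype.card_fin]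
  have hfib := Finset.card_eq_sum_card_fiberwise (s := cfg.J ×ˢ (univ : Finset (Fin d)))
    (t := cfg.lines) (f := fun q => cfg.lineAt q.1 q.2)
    fun q hq => cfg.lineAt_mem_lines (Finset.mem_product.1 hq).1 q.2
  rw [h] at hfib
  rw [hfib]
  rfl

/-- **Remark after Lemma 2.2, "in particular"** ("One can show that Example 1.1 is the exact
optimum under the additional hypothesis that every line in `𝓛` contains exactly the same number
`n` of joints … in particular, `C(k, d−1)` lines form at most `C(k, d)` joints"): a configuration
in `𝔽^d`, `d ≥ 2`, with `C(k, d−1)` chosen lines each containing exactly `n` of its joints has at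
most `C(k, d)` joints.
[cite: YuZhao2023JointsTightened, Remark after Lemma 2.2 (§2; arXiv v2, p. 4)] -/
theorem card_le_choose_of_card_onLine_eq (cfg : JointsConfig F d) (hd : 2 ≤ d) {n k : ℕ}
    (hn : ∀ ℓ ∈ cfg.lines, (cfg.onLine ℓ).card = n) (hL : cfg.lines.card = k.choose (d - 1)) :
    cfg.J.card ≤ k.choose d := by
  classical
  rcases cfg.J.eq_empty_or_nonempty with hJ | hJ
  · rw [hJ, Finset.card_empty]; exact Nat.zero_le _
  obtain ⟨p₀, hp₀⟩ := hJ
  have hℓ₀ : cfg.lineAt p₀ ⟨0, by omega⟩ ∈ cfg.lines := cfg.lineAt_mem_lines hp₀ _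
  -- `n ≥ 1` and `n L = d J`
  have hn1 : 1 ≤ n := by
    rw [← hn _ hℓ₀]
    exact Finset.card_pos.2 ⟨_, cfg.mem_onLine_self hp₀ _⟩
  have hcount : n * cfg.lines.card = cfg.J.card * d := by
    rw [← cfg.sum_card_onLine, Finset.sum_congr rfl hn, Finset.sum_const, smul_eq_mul, mul_comm]
  -- Lemma 2.2 with `β = 1`: `C(n + d − 1, d) ≤ J`
  have h22 := choose_le_card cfg ⟨p₀, hp₀⟩ n fun ℓ hℓ => (hn ℓ hℓ).ge
  -- hence `C(n + d − 1, d − 1) ≤ L = C(k, d − 1)` and `n + d − 1 ≤ k`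
  obtain ⟨e, rfl⟩ : ∃ e, d = e + 1 := ⟨d - 1, by omega⟩
  simp only [Nat.add_sub_cancel] at hL ⊢
  have hid : (n + e).choose (e + 1) * (e + 1) = (n + e).choose e * n := by
    rw [Nat.choose_succ_right_eq, Nat.add_sub_cancel]
  have hLge : (n + e).choose e ≤ k.choose e := by
    rw [← hL]
    have h1 : (n + e).choose e * n ≤ cfg.J.card * (e + 1) := by
      rw [← hid]; exact Nat.mul_le_mul_right _ (by simpa using h22)
    rw [← hcount] at h1
    exact Nat.le_of_mul_le_mul_left (by rw [mul_comm]; exact h1) (by omega)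
  have hk : n + e ≤ k := by
    by_contra! hlt
    have h1 : k.choose e ≤ (n + e - 1).choose e := Nat.choose_le_choose e (by omega)
    have h2 : (n + e - 1).choose e < (n + e).choose e := by
      obtain ⟨e', rfl⟩ : ∃ e', e = e' + 1 := ⟨e - 1, by omega⟩
      have hm : n + (e' + 1) = (n + e') + 1 := by omega
      have hm' : n + (e' + 1) - 1 = n + e' := by omega
      rw [hm', hm, Nat.choose_succ_succ' (n + e') e']
      have : 0 < (n + e').choose e' := Nat.choose_pos (by omega)
      omega
    omega
  -- so `J (e+1) = n L ≤ (k − e) C(k, e) = (e + 1) C(k, e + 1)`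
  have hfinal : cfg.J.card * (e + 1) ≤ k.choose (e + 1) * (e + 1) := by
    rw [← hcount, hL, Nat.choose_succ_right_eq]
    rw [mul_comm]
    exact Nat.mul_le_mul_left _ (by omega)
  exact Nat.le_of_mul_le_mul_right hfinal (by omega)

end JointsConfig

end EqualCounts

/-! ### Example 1.1: `C(k, d−1)` lines with `C(k, d)` joints -/
section Example

open scoped Matrix

/-- The flat cut out by the moment-curve hyperplanes `∑ᵢ xᵢ tⁱ = t^d`, `t ∈ T` (an explicit
instance of the "generic hyperplanes" of Example 1.1: any `d` of these hyperplanes are in general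
position by the Vandermonde determinant). [cite: YuZhao2023JointsTightened, Example 1.1 (§1; arXiv
v2, p. 1)] -/
def momentFlat (d : ℕ) (T : Finset F) : Set (Fin d → F) :=
  {x | ∀ t ∈ T, ∑ i : Fin d, x i * t ^ (i : ℕ) = t ^ d}

open scoped Classical in
/-- **The line family of Example 1.1:** the `(d−1)`-wise intersections of the `k = |A|`
moment-curve hyperplanes with parameters in `A`. [cite: YuZhao2023JointsTightened, Example 1.1 (§1;
arXiv v2, p. 1)] -/
noncomputable def exampleLines (d : ℕ) (A : Finset F) : Finset (Set (Fin d → F)) :=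
  (A.powersetCard (d - 1)).image (momentFlat d)

/-- Membership in a moment flat.
[cite: YuZhao2023JointsTightened, Example 1.1 (§1; arXiv v2, p. 1)] -/
theorem mem_momentFlat_iff {T : Finset F} {x : Fin d → F} :
    x ∈ momentFlat d T ↔ ∀ t ∈ T, ∑ i : Fin d, x i * t ^ (i : ℕ) = t ^ d :=
  Iff.rfl

/-- **The example has at most `C(k, d−1)` lines.**
[cite: YuZhao2023JointsTightened, Example 1.1 (§1; arXiv v2, p. 1)] -/
theorem card_exampleLines_le (d : ℕ) (A : Finset F) :
    (exampleLines d A).card ≤ A.card.choose (d - 1) := by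
  classical
  unfold exampleLines
  exact Finset.card_image_le.trans (Finset.card_powersetCard _ _).le

omit [Field F] in
/-- A `d`-element set of parameters has an injective enumeration by `Fin d`. [folklore] -/
private theorem exists_enum {S : Finset F} (hS : S.card = d) :
    ∃ s : Fin d → F, Function.Injective s ∧ (∀ j, s j ∈ S) ∧ ∀ t ∈ S, ∃ j, s j = t := by
  let e : ↥S ≃ Fin d := S.equivFin.trans (finCongr hS)
  refine ⟨fun j => (e.symm j : F), fun a b h => e.symm.injective (Subtype.ext h),
    fun j => (e.symm j).2, fun t ht => ⟨e ⟨t, ht⟩, by simp⟩⟩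

/-- The Vandermonde system `∑ᵢ pᵢ s_jⁱ = s_j^d` (`j < d`) of `d` distinct parameters has a
solution. [folklore] -/
private theorem exists_solution {s : Fin d → F} (hs : Function.Injective s) :
    ∃ p : Fin d → F, ∀ j, ∑ i : Fin d, p i * s j ^ (i : ℕ) = s j ^ d := by
  classical
  set V := Matrix.vandermonde s with hV
  have hdet : IsUnit V.det := (Matrix.det_vandermonde_ne_zero_iff.2 hs).isUnit
  refine ⟨V⁻¹ *ᵥ fun j => s j ^ d, fun j => ?_⟩
  have h := congr_fun (show V *ᵥ (V⁻¹ *ᵥ fun j => s j ^ d) = fun j => s j ^ d by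
    rw [Matrix.mulVec_mulVec, Matrix.mul_nonsing_inv _ hdet, Matrix.one_mulVec]) j
  simp only [Matrix.mulVec, dotProduct, hV, Matrix.vandermonde_apply] at h
  rw [← h]
  exact Finset.sum_congr rfl fun i _ => mul_comm _ _

open scoped Classical in
/-- With an injective enumeration `s` of `d` parameters and a solution `p` of the Vandermonde
system `∑ᵢ pᵢ s_jⁱ = s_j^d`, the moment flat of the parameters `{s_j : j ≠ m}` is the line
`p + F · V⁻¹ e_m` (`V_{j,i} = s_jⁱ`). [folklore] -/
private theorem momentFlat_erase_eq_line {s : Fin d → F} (hs : Function.Injective s)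
    {p : Fin d → F} (hp : ∀ j, ∑ i : Fin d, p i * s j ^ (i : ℕ) = s j ^ d) (m : Fin d) :
    momentFlat d ((univ.image s).erase (s m)) =
      line F p ((Matrix.vandermonde s)⁻¹ *ᵥ (Pi.single m 1 : Fin d → F)) := by
  set V := Matrix.vandermonde s with hV
  have hdet : IsUnit V.det := (Matrix.det_vandermonde_ne_zero_iff.2 hs).isUnit
  have hVmul : ∀ y : Fin d → F, ∀ j, (V *ᵥ y) j = ∑ i, y i * s j ^ (i : ℕ) := by
    intro y j
    simp only [Matrix.mulVec, dotProduct, hV, Matrix.vandermonde_apply]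
    exact Finset.sum_congr rfl fun i _ => mul_comm _ _
  set w := V⁻¹ *ᵥ (Pi.single m 1 : Fin d → F) with hw
  have hVw : V *ᵥ w = Pi.single m 1 := by
    rw [hw, Matrix.mulVec_mulVec, Matrix.mul_nonsing_inv _ hdet, Matrix.one_mulVec]
  have hmem_erase : ∀ t, t ∈ (univ.image s).erase (s m) ↔ ∃ j, j ≠ m ∧ s j = t := by
    intro t
    simp only [Finset.mem_erase, Finset.mem_image, mem_univ, true_and]
    constructor
    · rintro ⟨hne, j, rfl⟩
      exact ⟨j, fun h => hne (by rw [h]), rfl⟩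
    · rintro ⟨j, hj, rfl⟩
      exact ⟨fun h => hj (hs h), j, rfl⟩
  ext x
  rw [mem_momentFlat_iff, mem_line_iff]
  constructor
  · intro hx
    -- `V (x − p)` vanishes off `m`, hence `x − p = c • w`
    set c := (V *ᵥ (x - p)) m with hc
    have hVy : V *ᵥ (x - p) = c • (Pi.single m 1 : Fin d → F) := by
      funext j
      by_cases hj : j = m
      · subst hj; simp [hc]
      · rw [Pi.smul_apply, Pi.single_apply, if_neg hj, smul_zero, hVmul]
        simp only [Pi.sub_apply, sub_mul, Finset.sum_sub_distrib, hp j]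
        rw [hx (s j) ((hmem_erase _).2 ⟨j, hj, rfl⟩), sub_self]
    refine ⟨c, ?_⟩
    have : x - p = c • w := by
      have h1 : V⁻¹ *ᵥ (V *ᵥ (x - p)) = x - p := by
        rw [Matrix.mulVec_mulVec, Matrix.nonsing_inv_mul _ hdet, Matrix.one_mulVec]
      rw [← h1, hVy, Matrix.mulVec_smul]
    rw [← this, add_sub_cancel]
  · rintro ⟨c, rfl⟩ t ht
    obtain ⟨j, hj, rfl⟩ := (hmem_erase t).1 ht
    rw [← hVmul, Matrix.mulVec_add, Matrix.mulVec_smul, hVw, Pi.add_apply, Pi.smul_apply,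
      Pi.single_apply, if_neg hj, smul_zero, add_zero, hVmul, hp j]

/-- **Every `d`-wise intersection of the example is a joint:** for `d` distinct parameters
`s₀, …, s_{d−1} ∈ A` and the solution `p` of the Vandermonde system `∑ᵢ pᵢ s_jⁱ = s_j^d`, the
point `p` lies on the `d` lines `momentFlat {s_j : j ≠ m}` of the family, whose directions
`V⁻¹ e_m` are linearly independent. [cite: YuZhao2023JointsTightened, Example 1.1 (§1; arXiv v2,
p. 1)] -/
theorem isJoint_exampleLines {A : Finset F} {s : Fin d → F}
    (hs : Function.Injective s) (hsA : ∀ j, s j ∈ A) {p : Fin d → F}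
    (hp : ∀ j, ∑ i : Fin d, p i * s j ^ (i : ℕ) = s j ^ d) : IsJoint (exampleLines d A) p := by
  classical
  set V := Matrix.vandermonde s with hV
  have hdet : IsUnit V.det := (Matrix.det_vandermonde_ne_zero_iff.2 hs).isUnit
  refine ⟨fun m => V⁻¹ *ᵥ (Pi.single m 1 : Fin d → F), ?_, fun m => ?_⟩
  · -- the directions are the columns of `V⁻¹`
    have hcol : (fun m => V⁻¹ *ᵥ (Pi.single m (1 : F) : Fin d → F)) = (V⁻¹).col := by
      funext m
      exact Matrix.mulVec_single_one _ _
    rw [hcol]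
    refine Matrix.linearIndependent_cols_of_isUnit ((Matrix.isUnit_iff_isUnit_det _).2 ?_)
    rw [Matrix.det_nonsing_inv]
    exact hdet.ringInverse
  · rw [← momentFlat_erase_eq_line hs hp m]
    unfold exampleLines
    refine Finset.mem_image_of_mem _ (Finset.mem_powersetCard.2 ⟨?_, ?_⟩)
    · intro t ht
      rw [Finset.mem_erase, Finset.mem_image] at ht
      obtain ⟨-, j, -, rfl⟩ := ht
      exact hsA j
    · rw [Finset.card_erase_of_mem (Finset.mem_image_of_mem _ (mem_univ m)),
        Finset.card_image_of_injective _ hs, Finset.card_univ, Fintype.card_fin]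

/-- A point lies on at most `d` of the moment-curve hyperplanes: if `∑ᵢ pᵢ tⁱ = t^d` for all
`t ∈ T` then `|T| ≤ d`, since `X^d − ∑ᵢ pᵢ Xⁱ` has at most `d` roots. [folklore] -/
private theorem card_le_of_forall_sum_eq {T : Finset F} {p : Fin d → F}
    (hp : ∀ t ∈ T, ∑ i : Fin d, p i * t ^ (i : ℕ) = t ^ d) : T.card ≤ d := by
  classical
  rcases Nat.eq_zero_or_pos d with hd | hd
  · subst hd
    rcases T.eq_empty_or_nonempty with hT | ⟨t, ht⟩
    · simp [hT]
    · exfalso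
      have := hp t ht
      simp at this
  set Q : Polynomial F := ∑ i : Fin d, Polynomial.C (p i) * Polynomial.X ^ (i : ℕ) with hQ
  set P : Polynomial F := Polynomial.X ^ d - Q with hP
  have hQdeg : Q.natDegree < d :=
    lt_of_le_of_lt (Polynomial.natDegree_sum_le_of_forall_le _ _ fun i _ =>
      (Polynomial.natDegree_C_mul_X_pow_le (p i) i).trans (Nat.le_sub_one_of_lt i.isLt)) (by omega)
  have hPdeg : P.natDegree = d := by
    rw [hP, Polynomial.natDegree_sub_eq_left_of_natDegree_lt (by rwa [Polynomial.natDegree_X_pow]),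
      Polynomial.natDegree_X_pow]
  have hP0 : P ≠ 0 := by
    intro h
    rw [h, Polynomial.natDegree_zero] at hPdeg
    omega
  have hroots : T.val ⊆ P.roots := by
    intro t ht
    rw [Polynomial.mem_roots hP0, Polynomial.IsRoot.def]
    have h := hp t (by simpa using ht)
    simp only [hP, hQ, Polynomial.eval_sub, Polynomial.eval_pow, Polynomial.eval_X,
      Polynomial.eval_finsetSum, Polynomial.eval_mul, Polynomial.eval_C]
    rw [h, sub_self]
  rw [← hPdeg]
  exact Polynomial.card_le_degree_of_subset_roots hroots

/-- **The example has at least `C(k, d)` joints** (`d ≥ 2`): the `d`-wise intersections are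
joints, and distinct `d`-subsets of the parameters give distinct points (a point lies on at most
`d` of the hyperplanes). [cite: YuZhao2023JointsTightened, Example 1.1 (§1; arXiv v2, p. 1)] -/
theorem choose_le_ncard_joints_exampleLines (hd : 2 ≤ d) (A : Finset F) :
    A.card.choose d ≤ (joints (exampleLines d A)).ncard := by
  classical
  have key : ∀ S ∈ A.powersetCard d, ∃ p : Fin d → F,
      (∀ t ∈ S, ∑ i : Fin d, p i * t ^ (i : ℕ) = t ^ d) ∧ IsJoint (exampleLines d A) p := by
    intro S hS
    obtain ⟨hSA, hcard⟩ := Finset.mem_powersetCard.1 hS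
    obtain ⟨s, hs, hsS, hSs⟩ := exists_enum hcard
    obtain ⟨p, hp⟩ := exists_solution hs
    refine ⟨p, fun t ht => ?_, isJoint_exampleLines hs (fun j => hSA (hsS j)) hp⟩
    obtain ⟨j, rfl⟩ := hSs t ht
    exact hp j
  choose! pt hpt hjoint using key
  have hinj : Set.InjOn pt ↑(A.powersetCard d) := by
    intro S hS S' hS' heq
    by_contra hne
    have hcardS := (Finset.mem_powersetCard.1 hS).2
    have hcardS' := (Finset.mem_powersetCard.1 hS').2
    have hss : S ⊂ S ∪ S' := by
      refine Finset.ssubset_iff_subset_ne.2 ⟨Finset.subset_union_left, fun h => hne ?_⟩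
      have h' : S' ⊆ S := by rw [h]; exact Finset.subset_union_right
      exact (Finset.eq_of_subset_of_card_le h' (by rw [hcardS, hcardS'])).symm
    have hlt : d < (S ∪ S').card := by
      calc d = S.card := hcardS.symm
        _ < _ := Finset.card_lt_card hss
    have hle : (S ∪ S').card ≤ d := card_le_of_forall_sum_eq (p := pt S) fun t ht => by
      rcases Finset.mem_union.1 ht with h | h
      · exact hpt S hS t h
      · rw [heq]; exact hpt S' hS' t h
    omega
  calc A.card.choose d = (A.powersetCard d).card := (Finset.card_powersetCard _ _).symm
    _ = ((A.powersetCard d).image pt).card := (Finset.card_image_of_injOn hinj).symm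
    _ = (↑((A.powersetCard d).image pt) : Set (Fin d → F)).ncard := (Set.ncard_coe_finset _).symm
    _ ≤ (joints (exampleLines d A)).ncard := by
        refine Set.ncard_le_ncard (fun x hx => ?_) (joints_finite hd _)
        obtain ⟨S, hS, rfl⟩ := Finset.mem_image.1 (Finset.mem_coe.1 hx)
        exact hjoint S hS

/-- **The members of the example family are lines** (when `d ≤ k`, so that every `(d−1)`-set of
parameters extends to a `d`-set). [cite: YuZhao2023JointsTightened, Example 1.1 (§1; arXiv v2,
p. 1)] -/
theorem isLine_of_mem_exampleLines (hd : 1 ≤ d) {A : Finset F} (hA : d ≤ A.card)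
    {ℓ : Set (Fin d → F)} (hℓ : ℓ ∈ exampleLines d A) : IsLine ℓ := by
  classical
  unfold exampleLines at hℓ
  obtain ⟨T, hT, rfl⟩ := Finset.mem_image.1 hℓ
  obtain ⟨hTA, hTcard⟩ := Finset.mem_powersetCard.1 hT
  obtain ⟨a, haA, haT⟩ := Finset.exists_mem_notMem_of_card_lt_card (s := T) (t := A) (by omega)
  have hScard : (insert a T).card = d := by
    rw [Finset.card_insert_of_notMem haT]
    omega
  obtain ⟨s, hs, hsS, hSs⟩ := exists_enum hScard
  obtain ⟨p, hp⟩ := exists_solution hs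
  obtain ⟨m, hm⟩ := hSs a (Finset.mem_insert_self a T)
  have hT' : T = (univ.image s).erase (s m) := by
    have himg : univ.image s = insert a T := by
      ext t
      simp only [Finset.mem_image, mem_univ, true_and]
      constructor
      · rintro ⟨j, rfl⟩
        exact hsS j
      · intro ht
        obtain ⟨j, rfl⟩ := hSs t ht
        exact ⟨j, rfl⟩
    rw [himg, hm, Finset.erase_insert haT]
  rw [hT', momentFlat_erase_eq_line hs hp m]
  refine ⟨p, _, ?_, rfl⟩
  -- the direction `V⁻¹ e_m` is nonzero since `V (V⁻¹ e_m) = e_m ≠ 0`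
  intro h0
  have hdet : IsUnit (Matrix.vandermonde s).det := (Matrix.det_vandermonde_ne_zero_iff.2 hs).isUnit
  have : (Matrix.vandermonde s) *ᵥ ((Matrix.vandermonde s)⁻¹ *ᵥ (Pi.single m 1 : Fin d → F)) =
      Pi.single m 1 := by
    rw [Matrix.mulVec_mulVec, Matrix.mul_nonsing_inv _ hdet, Matrix.one_mulVec]
  rw [h0, Matrix.mulVec_zero] at this
  have h1 := congr_fun this m
  rw [Pi.zero_apply, Pi.single_eq_same] at h1
  exact one_ne_zero h1.symm

/-- **Example 1.1 against Theorem 1.3, lower side:** the family `exampleLines d A` (`k = |A|`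
parameters, `d ≥ 2`) has at most `C(k, d−1)` lines and at least `C(k, d)` joints, so
`(k − d + 1) · |L| ≤ d · |joints L|` for it (`C(k, d) d = C(k, d−1)(k − d + 1)`).
[cite: YuZhao2023JointsTightened, Example 1.1 (§1; arXiv v2, p. 1)] -/
theorem sub_mul_card_exampleLines_le (hd : 2 ≤ d) (A : Finset F) :
    (A.card - (d - 1)) * (exampleLines d A).card ≤ d * (joints (exampleLines d A)).ncard := by
  have h1 := card_exampleLines_le d A
  have h2 := choose_le_ncard_joints_exampleLines hd A
  obtain ⟨e, rfl⟩ : ∃ e, d = e + 1 := ⟨d - 1, by omega⟩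
  simp only [Nat.add_sub_cancel] at h1 ⊢
  have hid : A.card.choose (e + 1) * (e + 1) = A.card.choose e * (A.card - e) :=
    Nat.choose_succ_right_eq _ _
  calc (A.card - e) * (exampleLines (e + 1) A).card ≤ (A.card - e) * A.card.choose e :=
        Nat.mul_le_mul_left _ h1
    _ = A.card.choose (e + 1) * (e + 1) := by rw [hid, mul_comm]
    _ ≤ (joints (exampleLines (e + 1) A)).ncard * (e + 1) := Nat.mul_le_mul_right _ h2
    _ = (e + 1) * (joints (exampleLines (e + 1) A)).ncard := mul_comm _ _

/-- **Example 1.1 against Theorem 1.3, upper side** (the bound "matches, up to a `1 + o(1)`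
factor, the best known construction"): by Theorem 1.3, EVERY family of at most `C(k, d−1)` lines
in `F^d` has `d · |joints L| ≤ k · |L|` (from `|J|^{d−1} d^{d−1} ≤ (d−1)! |L|^d` and
`(d−1)! C(k, d−1) ≤ k^{d−1}`) — against `(k − d + 1) · |L| ≤ d · |joints L|` for the example.
[cite: YuZhao2023JointsTightened, Theorem 1.3 and Example 1.1 (§1; arXiv v2, p. 1)] -/
theorem mul_ncard_joints_le_of_card_le_choose (hd : 2 ≤ d) (L : Finset (Set (Fin d → F)))
    {k : ℕ} (hL : L.card ≤ k.choose (d - 1)) : d * (joints L).ncard ≤ k * L.card := by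
  have h := ncard_joints_pow_mul_pow_le hd L
  have hdesc : (d - 1).factorial * k.choose (d - 1) ≤ k ^ (d - 1) := by
    rw [← Nat.descFactorial_eq_factorial_mul_choose]
    exact Nat.descFactorial_le_pow _ _
  obtain ⟨e, rfl⟩ : ∃ e, d = e + 1 := ⟨d - 1, by omega⟩
  simp only [Nat.add_sub_cancel] at h hdesc hL ⊢
  have key : ((e + 1) * (joints L).ncard) ^ e ≤ (k * L.card) ^ e := by
    rw [mul_pow, mul_pow, mul_comm]
    calc (joints L).ncard ^ e * (e + 1) ^ e ≤ e.factorial * L.card ^ (e + 1) := h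
      _ = e.factorial * L.card * L.card ^ e := by rw [pow_succ]; ring
      _ ≤ e.factorial * k.choose e * L.card ^ e :=
          Nat.mul_le_mul_right _ (Nat.mul_le_mul_left _ hL)
      _ ≤ k ^ e * L.card ^ e := Nat.mul_le_mul_right _ hdesc
  exact (Nat.pow_le_pow_iff_left (by omega)).1 key

end Example

/-! ### §3: Multijoints (Theorem 3.2) -/
section Multijoints

open Real

/-- **`p` is a multijoint of the families `L₀, …, L_{d−1}`** (Yu–Zhao, §3: "`(𝓙, 𝓛₁, …, 𝓛_d)` is
a multijoints configuration in `𝔽^d` if each `𝓛ᵢ` is a set of lines and `𝓙` is a set of points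
each being the intersection of exactly one line from each `𝓛ᵢ`, not all lying on the same
hyperplane"): there are lines `ℓᵢ ∈ Lᵢ` through `p`, one from each family, with linearly
independent directions. [cite: YuZhao2023JointsTightened, §3 (arXiv v2, p. 5)] -/
def IsMultijoint (L : Fin d → Finset (Set (Fin d → F))) (p : Fin d → F) : Prop :=
  ∃ v : Fin d → Fin d → F, LinearIndependent F v ∧ ∀ i, line F p (v i) ∈ L i

/-- **The set of multijoints** of the families `L₀, …, L_{d−1}`.
[cite: YuZhao2023JointsTightened, §3 (arXiv v2, p. 5)] -/
def multijoints (L : Fin d → Finset (Set (Fin d → F))) : Set (Fin d → F) :=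
  {p | IsMultijoint L p}

/-- A multijoint of `L₀, …, L_{d−1}` is a joint of the union family ("Theorem 3.1 implies
Theorem 1.2"). [cite: YuZhao2023JointsTightened, Remark after Theorem 3.1 (§3; arXiv v2, p. 6)] -/
theorem IsMultijoint.isJoint_biUnion [DecidableEq (Set (Fin d → F))]
    {L : Fin d → Finset (Set (Fin d → F))} {p : Fin d → F} (hp : IsMultijoint L p) :
    IsJoint (Finset.univ.biUnion L) p := by
  obtain ⟨v, hv, hL⟩ := hp
  exact ⟨v, hv, fun i => Finset.mem_biUnion.2 ⟨i, mem_univ i, hL i⟩⟩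

/-- The multijoints of finitely many finite families form a finite set (`d ≥ 2`).
[cite: YuZhao2023JointsTightened, §3 (arXiv v2, p. 5)] -/
theorem multijoints_finite (hd : 2 ≤ d) (L : Fin d → Finset (Set (Fin d → F))) :
    (multijoints L).Finite := by
  classical
  exact (joints_finite hd (Finset.univ.biUnion L)).subset fun p hp =>
    IsMultijoint.isJoint_biUnion hp

namespace JointsConfig

/-- The `i`-th chosen lines `{ℓ_{p,i} : p ∈ 𝓙}` of a configuration — for a multijoints
configuration, the lines of `𝓛ᵢ` that are used. [cite: YuZhao2023JointsTightened, §3 (arXiv v2,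
p. 6: "`b_{p,i} = b_{p,ℓ}` where `ℓ` is the line in `𝓛ᵢ` that contains `p`")] -/
noncomputable def linesAt [DecidableEq (Set (Fin d → F))] (cfg : JointsConfig F d) (i : Fin d) :
    Finset (Set (Fin d → F)) :=
  cfg.J.image fun p => cfg.lineAt p i

/-- **`∑_p b_{p,i} ≤ |𝓛ᵢ|`** ("`∑_{ℓ ∈ 𝓛ᵢ} ∑_{p ∈ ℓ} b_{p,i}`", each inner sum being at most the
full line sum `1`): for nonnegative weights with line sums `1`, the weights with direction index
`i` sum to at most the number of `i`-th chosen lines.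
[cite: YuZhao2023JointsTightened, Theorem 3.2 (proof; arXiv v2, p. 6)] -/
theorem sum_le_card_linesAt [DecidableEq (Set (Fin d → F))] (cfg : JointsConfig F d)
    (b : (Fin d → F) → Fin d → ℝ) (hb0 : ∀ p ∈ cfg.J, ∀ i, 0 ≤ b p i)
    (hb : ∀ ℓ ∈ cfg.lines, ∑ q ∈ cfg.onLine ℓ, b q.1 q.2 = 1) (i : Fin d) :
    ∑ p ∈ cfg.J, b p i ≤ (cfg.linesAt i).card := by
  classical
  rw [← Finset.sum_fiberwise_of_maps_to (s := cfg.J) (t := cfg.linesAt i)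
    (g := fun p => cfg.lineAt p i) (fun p hp => Finset.mem_image_of_mem _ hp)]
  have h : ∀ ℓ ∈ cfg.linesAt i, ∑ p ∈ cfg.J with cfg.lineAt p i = ℓ, b p i ≤ 1 := by
    intro ℓ hℓ
    obtain ⟨p₀, hp₀, rfl⟩ := Finset.mem_image.1 hℓ
    rw [← hb _ (cfg.lineAt_mem_lines hp₀ i)]
    -- the incidences `(p, i)` with `ℓ_{p,i} = ℓ` form a subset of `onLine ℓ`
    rw [← Finset.sum_image (f := fun q : (Fin d → F) × Fin d => b q.1 q.2)
      (s := cfg.J.filter fun p => cfg.lineAt p i = cfg.lineAt p₀ i) (g := fun p => (p, i))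
      (fun p _ p' _ h => (Prod.ext_iff.1 h).1)]
    refine Finset.sum_le_sum_of_subset_of_nonneg (fun q hq => ?_) fun q hq _ =>
      hb0 q.1 (cfg.mem_onLine_iff.1 hq).1 q.2
    obtain ⟨p, hp, rfl⟩ := Finset.mem_image.1 hq
    obtain ⟨hpJ, hpℓ⟩ := Finset.mem_filter.1 hp
    exact cfg.mem_onLine_iff.2 ⟨hpJ, hpℓ⟩
  calc ∑ ℓ ∈ cfg.linesAt i, ∑ p ∈ cfg.J with cfg.lineAt p i = ℓ, b p i
      ≤ ∑ ℓ ∈ cfg.linesAt i, (1 : ℝ) := Finset.sum_le_sum h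
    _ = (cfg.linesAt i).card := by rw [Finset.sum_const, nsmul_eq_mul, mul_one]

/-- **Proof of Theorem 3.2, connected case** ("By the AM–GM inequality,
`d J W^{1/d} (L₁⋯L_d)^{−1/d} = ∑_p d (∏ᵢ b_{p,i}/Lᵢ)^{1/d} ≤ ∑_p ∑ᵢ b_{p,i}/Lᵢ =
∑ᵢ Lᵢ^{−1} ∑_{ℓ ∈ 𝓛ᵢ} ∑_{p ∈ ℓ} b_{p,i} ≤ d`. So `W ≤ |𝓛₁|⋯|𝓛_d|/J^d`; and hence by Lemma 2.3
`1/d! ≤ J W`"): for a connected nonempty configuration, `|𝓙|^{d−1} ≤ d! ∏ᵢ |𝓛ᵢ|` with `𝓛ᵢ` its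
`i`-th chosen lines.
[cite: YuZhao2023JointsTightened, Theorem 3.2 (proof; arXiv v2, p. 6)] -/
theorem card_pow_le_factorial_mul_prod_of_isConnected [DecidableEq (Set (Fin d → F))]
    (cfg : JointsConfig F d) (hJ : cfg.J.Nonempty) (hconn : cfg.IsConnected) (hd : 1 ≤ d) :
    (cfg.J.card : ℝ) ^ (d - 1) ≤ d.factorial * ∏ i, ((cfg.linesAt i).card : ℝ) := by
  classical
  obtain ⟨a, b, W, hb0, ha, hb, hW⟩ := cfg.exists_weights_prod_eq hJ hconn
  set J := (cfg.J.card : ℝ) with hJdef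
  set Lc : Fin d → ℝ := fun i => ((cfg.linesAt i).card : ℝ) with hLc
  have hJpos : 0 < J := by simp only [hJdef]; exact_mod_cast hJ.card_pos
  have hdR : (0 : ℝ) < d := by exact_mod_cast hd
  have hLpos : ∀ i, 0 < Lc i := by
    intro i
    obtain ⟨p₀, hp₀⟩ := hJ
    simp only [hLc]
    exact_mod_cast Finset.card_pos.2 ⟨_, Finset.mem_image_of_mem _ hp₀⟩
  have hPpos : 0 < ∏ i, Lc i := Finset.prod_pos fun i _ => hLpos i
  -- Lemma 2.3: `1/d! ≤ J W`, so `W > 0`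
  have h23 : (1 : ℝ) / d.factorial ≤ J * W := by
    have h := inv_factorial_le_sum_prod cfg hJ a b hb0
      (fun p hp p' hp' i i' hline _ => ha p hp p' hp' i i' hline) hb
    rwa [Finset.sum_congr rfl fun p hp => hW p hp, Finset.sum_const, nsmul_eq_mul] at h
  have hWpos : 0 < W := by
    have : 0 < J * W := lt_of_lt_of_le (by positivity) h23
    by_contra hle
    push Not at hle
    nlinarith
  -- weighted AM–GM at each joint: `d (W / ∏ L)^{1/d} ≤ ∑ᵢ b_{p,i}/Lᵢ`
  have hAM : ∀ p ∈ cfg.J, (d : ℝ) * (W / ∏ i, Lc i) ^ ((1 : ℝ) / d) ≤ ∑ i, b p i / Lc i := by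
    intro p hp
    have h := Real.geom_mean_le_arith_mean_weighted (univ : Finset (Fin d)) (fun _ => (1 : ℝ) / d)
      (fun i => b p i / Lc i) (fun _ _ => by positivity)
      (by rw [Finset.sum_const, Finset.card_univ, Fintype.card_fin, nsmul_eq_mul]; field_simp)
      (fun i _ => div_nonneg (hb0 p hp i) (hLpos i).le)
    rw [Real.finsetProd_rpow _ _ (fun i _ => div_nonneg (hb0 p hp i) (hLpos i).le),
      Finset.prod_div_distrib, hW p hp, ← Finset.mul_sum] at h
    calc (d : ℝ) * (W / ∏ i, Lc i) ^ ((1 : ℝ) / d) ≤ d * ((1 / d) * ∑ i, b p i / Lc i) :=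
          mul_le_mul_of_nonneg_left h hdR.le
      _ = ∑ i, b p i / Lc i := by field_simp
  -- summing over the joints: `J d (W/∏L)^{1/d} ≤ ∑ᵢ (∑_p b_{p,i}) / Lᵢ ≤ d`
  have hsum : J * ((d : ℝ) * (W / ∏ i, Lc i) ^ ((1 : ℝ) / d)) ≤ d := by
    calc J * ((d : ℝ) * (W / ∏ i, Lc i) ^ ((1 : ℝ) / d))
        = ∑ _p ∈ cfg.J, (d : ℝ) * (W / ∏ i, Lc i) ^ ((1 : ℝ) / d) := by
          rw [Finset.sum_const, nsmul_eq_mul]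
      _ ≤ ∑ p ∈ cfg.J, ∑ i, b p i / Lc i := Finset.sum_le_sum hAM
      _ = ∑ i, (∑ p ∈ cfg.J, b p i) / Lc i := by
          rw [Finset.sum_comm]
          exact Finset.sum_congr rfl fun i _ => by rw [Finset.sum_div]
      _ ≤ ∑ _i : Fin d, (1 : ℝ) := Finset.sum_le_sum fun i _ =>
          (div_le_one (hLpos i)).2 (cfg.sum_le_card_linesAt b hb0 hb i)
      _ = d := by rw [Finset.sum_const, Finset.card_univ, Fintype.card_fin, nsmul_eq_mul, mul_one]
  -- hence `J^d W ≤ ∏ L` and `J^{d−1} ≤ d! ∏ L`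
  have hle1 : J * (W / ∏ i, Lc i) ^ ((1 : ℝ) / d) ≤ 1 := by
    have := hsum
    rw [← mul_assoc, mul_comm J, mul_assoc] at this
    exact (mul_le_iff_le_one_right hdR).1 this
  have hq0 : 0 ≤ W / ∏ i, Lc i := div_nonneg hWpos.le hPpos.le
  have hs : ((W / ∏ i, Lc i) ^ ((1 : ℝ) / d)) ^ d = W / ∏ i, Lc i := by
    rw [one_div]
    exact Real.rpow_inv_natCast_pow hq0 (by omega)
  have h1 : J ^ d * (W / ∏ i, Lc i) ≤ 1 := by
    have := pow_le_pow_left₀ (mul_nonneg hJpos.le (Real.rpow_nonneg hq0 _)) hle1 d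
    rwa [mul_pow, hs, one_pow] at this
  have h2 : J ^ d * W ≤ ∏ i, Lc i := by
    rw [← mul_div_assoc, div_le_iff₀ hPpos] at h1
    simpa using h1
  have h3 : 1 ≤ (d.factorial : ℝ) * (J * W) := by
    have := mul_le_mul_of_nonneg_left h23 (show (0 : ℝ) ≤ d.factorial by positivity)
    rwa [mul_one_div_cancel (by positivity)] at this
  obtain ⟨k, rfl⟩ : ∃ k, d = k + 1 := ⟨d - 1, by omega⟩
  simp only [Nat.add_sub_cancel]
  calc J ^ k ≤ J ^ k * (((k + 1).factorial : ℝ) * (J * W)) :=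
        le_mul_of_one_le_right (pow_nonneg hJpos.le _) h3
    _ = (k + 1).factorial * (J ^ (k + 1) * W) := by ring
    _ ≤ (k + 1).factorial * ∏ i, Lc i := mul_le_mul_of_nonneg_left h2 (Nat.cast_nonneg _)

/-- **Superadditivity of `(∏ᵢ aᵢ)^{1/(d−1)}`** (the step "we can reduce to the case of a connected
configuration" for multijoints): for nonnegative `a, b ∈ ℝ^d`, `d ≥ 2`,
`(∏ aᵢ)^{1/(d−1)} + (∏ bᵢ)^{1/(d−1)} ≤ (∏ (aᵢ + bᵢ))^{1/(d−1)}` (by AM–GM for the ratios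
`aᵢ/(aᵢ+bᵢ)`, `bᵢ/(aᵢ+bᵢ)` and `x^{1/(d−1)} ≤ x^{1/d}` on `[0, 1]`). [folklore] -/
private theorem prod_rpow_add_prod_rpow_le (hd : 2 ≤ d) (a b : Fin d → ℝ) (ha : ∀ i, 0 ≤ a i)
    (hb : ∀ i, 0 ≤ b i) :
    (∏ i, a i) ^ ((1 : ℝ) / (d - 1)) + (∏ i, b i) ^ ((1 : ℝ) / (d - 1)) ≤
      (∏ i, (a i + b i)) ^ ((1 : ℝ) / (d - 1)) := by
  have hdR : (2 : ℝ) ≤ d := by exact_mod_cast hd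
  have hr : (0 : ℝ) < 1 / (d - 1) := by
    have : (0 : ℝ) < d - 1 := by linarith
    positivity
  have hrd : (1 : ℝ) / d ≤ 1 / (d - 1) :=
    one_div_le_one_div_of_le (by linarith) (by linarith)
  by_cases hz : ∃ i, a i + b i = 0
  · obtain ⟨i, hi⟩ := hz
    have hai : a i = 0 := by linarith [ha i, hb i]
    have hbi : b i = 0 := by linarith [ha i, hb i]
    rw [Finset.prod_eq_zero (mem_univ i) hai, Finset.prod_eq_zero (mem_univ i) hbi,
      Finset.prod_eq_zero (mem_univ i) hi, Real.zero_rpow hr.ne', add_zero]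
  push Not at hz
  have hpos : ∀ i, 0 < a i + b i := fun i => lt_of_le_of_ne (add_nonneg (ha i) (hb i)) (hz i).symm
  have hP : 0 < ∏ i, (a i + b i) := Finset.prod_pos fun i _ => hpos i
  -- the ratios
  set u : Fin d → ℝ := fun i => a i / (a i + b i) with hu
  set v : Fin d → ℝ := fun i => b i / (a i + b i) with hv
  have hu0 : ∀ i, 0 ≤ u i := fun i => div_nonneg (ha i) (hpos i).le
  have hv0 : ∀ i, 0 ≤ v i := fun i => div_nonneg (hb i) (hpos i).le
  have huv : ∀ i, u i + v i = 1 := fun i => by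
    simp only [hu, hv]
    rw [← add_div, div_self (hpos i).ne']
  have hu1 : ∀ i, u i ≤ 1 := fun i => by linarith [huv i, hv0 i]
  have hv1 : ∀ i, v i ≤ 1 := fun i => by linarith [huv i, hu0 i]
  have hfa : ∏ i, a i = (∏ i, u i) * ∏ i, (a i + b i) := by
    rw [← Finset.prod_mul_distrib]
    exact Finset.prod_congr rfl fun i _ => by simp only [hu]; rw [div_mul_cancel₀ _ (hpos i).ne']
  have hfb : ∏ i, b i = (∏ i, v i) * ∏ i, (a i + b i) := by
    rw [← Finset.prod_mul_distrib]
    exact Finset.prod_congr rfl fun i _ => by simp only [hv]; rw [div_mul_cancel₀ _ (hpos i).ne']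
  -- AM–GM with exponent `1/d`, then lower the exponent to `1/(d−1)` on `[0,1]`
  have hAM : ∀ w : Fin d → ℝ, (∀ i, 0 ≤ w i) → (∀ i, w i ≤ 1) →
      (∏ i, w i) ^ ((1 : ℝ) / (d - 1)) ≤ (1 / d) * ∑ i, w i := by
    intro w hw0 hw1
    have hprod0 : 0 ≤ ∏ i, w i := Finset.prod_nonneg fun i _ => hw0 i
    have hprod1 : ∏ i, w i ≤ 1 := Finset.prod_le_one (fun i _ => hw0 i) fun i _ => hw1 i
    have h := Real.geom_mean_le_arith_mean_weighted (univ : Finset (Fin d)) (fun _ => (1 : ℝ) / d)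
      w (fun _ _ => by positivity)
      (by rw [Finset.sum_const, Finset.card_univ, Fintype.card_fin, nsmul_eq_mul]; field_simp)
      (fun i _ => hw0 i)
    rw [Real.finsetProd_rpow _ _ (fun i _ => hw0 i), ← Finset.mul_sum] at h
    refine le_trans ?_ h
    rcases hprod0.eq_or_lt with h0 | h0
    · rw [← h0, Real.zero_rpow hr.ne', Real.zero_rpow (by positivity)]
    · exact Real.rpow_le_rpow_of_exponent_ge h0 hprod1 hrd
  have hsum : (1 / d : ℝ) * ∑ i, u i + (1 / d) * ∑ i, v i = 1 := by
    rw [← mul_add, ← Finset.sum_add_distrib, Finset.sum_congr rfl fun i _ => huv i,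
      Finset.sum_const, Finset.card_univ, Fintype.card_fin, nsmul_eq_mul, mul_one]
    field_simp
  rw [hfa, hfb, Real.mul_rpow (Finset.prod_nonneg fun i _ => hu0 i) hP.le,
    Real.mul_rpow (Finset.prod_nonneg fun i _ => hv0 i) hP.le, ← add_mul]
  calc ((∏ i, u i) ^ ((1 : ℝ) / (d - 1)) + (∏ i, v i) ^ ((1 : ℝ) / (d - 1))) *
        (∏ i, (a i + b i)) ^ ((1 : ℝ) / (d - 1))
      ≤ 1 * (∏ i, (a i + b i)) ^ ((1 : ℝ) / (d - 1)) := by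
        refine mul_le_mul_of_nonneg_right ?_ (by positivity)
        linarith [hAM u hu0 hu1, hAM v hv0 hv1]
    _ = _ := one_mul _

/-- Restricting a configuration restricts its `i`-th lines. [folklore] -/
private theorem linesAt_restrict_subset [DecidableEq (Set (Fin d → F))] (cfg : JointsConfig F d)
    (S : Finset (Fin d → F)) (hS : S ⊆ cfg.J) (i : Fin d) :
    (cfg.restrict S hS).linesAt i ⊆ cfg.linesAt i := by
  intro ℓ hℓ
  obtain ⟨p, hp, rfl⟩ := Finset.mem_image.1 hℓ
  exact Finset.mem_image_of_mem _ (hS hp)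

/-- **Theorem 3.2 (Yu–Zhao) for joints configurations:** a configuration in `𝔽^d`, `d ≥ 2`, has
`|𝓙| ≤ (d! ∏ᵢ |𝓛ᵢ|)^{1/(d−1)}`, `𝓛ᵢ` = its `i`-th chosen lines ("As before, we can reduce to case
of a connected configuration": a disconnected configuration splits along a cut, and
`(∏ aᵢ)^{1/(d−1)}` is superadditive). [cite: YuZhao2023JointsTightened, Theorem 3.2 (§3; arXiv
v2, p. 6)] -/
theorem card_le_rpow_prod_linesAt [DecidableEq (Set (Fin d → F))] (hd : 2 ≤ d)
    (cfg : JointsConfig F d) :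
    (cfg.J.card : ℝ) ≤ (d.factorial * ∏ i, ((cfg.linesAt i).card : ℝ)) ^ ((1 : ℝ) / (d - 1)) := by
  classical
  suffices h : ∀ (n : ℕ) (cfg : JointsConfig F d), cfg.J.card = n →
      (cfg.J.card : ℝ) ≤ (d.factorial * ∏ i, ((cfg.linesAt i).card : ℝ)) ^ ((1 : ℝ) / (d - 1)) from
    h _ cfg rfl
  intro n
  induction n using Nat.strong_induction_on with
  | _ n ih =>
    intro cfg hn
    have hdR : (2 : ℝ) ≤ d := by exact_mod_cast hd
    have hd1 : (0 : ℝ) < (d : ℝ) - 1 := by linarith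
    have hd1r : (0 : ℝ) < 1 / ((d : ℝ) - 1) := by positivity
    rcases cfg.J.eq_empty_or_nonempty with hJ | hJ
    · rw [hJ, Finset.card_empty, Nat.cast_zero]
      exact Real.rpow_nonneg (mul_nonneg (Nat.cast_nonneg _)
        (Finset.prod_nonneg fun i _ => Nat.cast_nonneg _)) _
    have hP0 : ∀ c : JointsConfig F d, (0 : ℝ) ≤ ∏ i, ((c.linesAt i).card : ℝ) := fun c =>
      Finset.prod_nonneg fun i _ => Nat.cast_nonneg _
    have hFP0 : ∀ c : JointsConfig F d, (0 : ℝ) ≤ d.factorial * ∏ i, ((c.linesAt i).card : ℝ) :=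
      fun c => mul_nonneg (Nat.cast_nonneg _) (hP0 c)
    by_cases hconn : cfg.IsConnected
    · have hpow := cfg.card_pow_le_factorial_mul_prod_of_isConnected hJ hconn (by omega)
      have hd1' : (d - 1 : ℕ) ≠ 0 := by omega
      have key := Real.rpow_le_rpow (pow_nonneg (Nat.cast_nonneg _) _) hpow
        (show (0 : ℝ) ≤ ((d - 1 : ℕ) : ℝ)⁻¹ by positivity)
      rw [Real.pow_rpow_inv_natCast (Nat.cast_nonneg _) hd1'] at key
      have hexp : ((1 : ℝ) / (d - 1)) = ((d - 1 : ℕ) : ℝ)⁻¹ := by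
        rw [Nat.cast_sub (by omega), Nat.cast_one, one_div]
      rwa [hexp]
    · unfold IsConnected at hconn
      push Not at hconn
      obtain ⟨S, hSJ, hSne, hSneJ, hnoX⟩ := hconn
      set cfg₁ := cfg.restrict S hSJ with hcfg₁
      set cfg₂ := cfg.restrict (cfg.J \ S) Finset.sdiff_subset with hcfg₂
      have hcard : cfg.J.card = S.card + (cfg.J \ S).card := by
        rw [add_comm, Finset.card_sdiff_add_card_eq_card hSJ]
      have hlt₁ : S.card < n :=
        hn ▸ Finset.card_lt_card (Finset.ssubset_iff_subset_ne.2 ⟨hSJ, hSneJ⟩)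
      have hlt₂ : (cfg.J \ S).card < n := by
        have := hSne.card_pos
        omega
      have ih₁ := ih _ hlt₁ cfg₁ rfl
      have ih₂ := ih _ hlt₂ cfg₂ rfl
      -- the `i`-th lines of the two parts are disjoint subsets of the `i`-th lines
      have hLle : ∀ i,
          ((cfg₁.linesAt i).card : ℝ) + (cfg₂.linesAt i).card ≤ (cfg.linesAt i).card := by
        intro i
        have hdisj : Disjoint (cfg₁.linesAt i) (cfg₂.linesAt i) := by
          rw [Finset.disjoint_left]
          intro ℓ h₁ h₂
          obtain ⟨p, hp, rfl⟩ := Finset.mem_image.1 h₁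
          obtain ⟨p', hp', h⟩ := Finset.mem_image.1 h₂
          exact hnoX p hp p' (Finset.mem_sdiff.1 hp').1 (Finset.mem_sdiff.1 hp').2 i i h.symm
        have hsub : cfg₁.linesAt i ∪ cfg₂.linesAt i ⊆ cfg.linesAt i :=
          Finset.union_subset (cfg.linesAt_restrict_subset S hSJ i)
            (cfg.linesAt_restrict_subset (cfg.J \ S) Finset.sdiff_subset i)
        have := Finset.card_le_card hsub
        rw [Finset.card_union_of_disjoint hdisj] at this
        exact_mod_cast this
      have hF : (0 : ℝ) ≤ d.factorial := by positivity
      calc (cfg.J.card : ℝ) = cfg₁.J.card + cfg₂.J.card := by rw [hcard]; push_cast; rfl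
        _ ≤ (d.factorial * ∏ i, ((cfg₁.linesAt i).card : ℝ)) ^ ((1 : ℝ) / (d - 1)) +
              (d.factorial * ∏ i, ((cfg₂.linesAt i).card : ℝ)) ^ ((1 : ℝ) / (d - 1)) :=
            add_le_add ih₁ ih₂
        _ = (d.factorial : ℝ) ^ ((1 : ℝ) / (d - 1)) *
              ((∏ i, ((cfg₁.linesAt i).card : ℝ)) ^ ((1 : ℝ) / (d - 1)) +
                (∏ i, ((cfg₂.linesAt i).card : ℝ)) ^ ((1 : ℝ) / (d - 1))) := by
            rw [Real.mul_rpow hF (hP0 cfg₁), Real.mul_rpow hF (hP0 cfg₂), mul_add]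
        _ ≤ (d.factorial : ℝ) ^ ((1 : ℝ) / (d - 1)) *
              (∏ i, (((cfg₁.linesAt i).card : ℝ) + (cfg₂.linesAt i).card)) ^ ((1 : ℝ) / (d - 1)) :=
            mul_le_mul_of_nonneg_left (prod_rpow_add_prod_rpow_le hd _ _
              (fun i => Nat.cast_nonneg _) fun i => Nat.cast_nonneg _) (Real.rpow_nonneg hF _)
        _ ≤ (d.factorial : ℝ) ^ ((1 : ℝ) / (d - 1)) *
              (∏ i, ((cfg.linesAt i).card : ℝ)) ^ ((1 : ℝ) / (d - 1)) :=
            mul_le_mul_of_nonneg_left (Real.rpow_le_rpow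
              (Finset.prod_nonneg fun i _ => add_nonneg (Nat.cast_nonneg _) (Nat.cast_nonneg _))
              (Finset.prod_le_prod (fun i _ => add_nonneg (Nat.cast_nonneg _) (Nat.cast_nonneg _))
                fun i _ => hLle i) hd1r.le) (Real.rpow_nonneg hF _)
        _ = (d.factorial * ∏ i, ((cfg.linesAt i).card : ℝ)) ^ ((1 : ℝ) / (d - 1)) := by
            rw [Real.mul_rpow hF (hP0 cfg)]

end JointsConfig

/-- **Theorem 3.2 (Yu–Zhao).** "Theorem 3.1 holds with `C^mult_d = d!^{1/(d−1)}`", i.e. every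
multijoints configuration `(𝓙; 𝓛₁, …, 𝓛_d)` in `𝔽^d` satisfies
`|𝓙| ≤ (d! |𝓛₁|⋯|𝓛_d|)^{1/(d−1)}` — here in the integer form `|multijoints L|^{d−1} ≤ d! ∏ᵢ |Lᵢ|`,
for every field `F`, `d ≥ 2` and finite families `L₀, …, L_{d−1}` (improving Zhang's constant
`d^{d/(d−1)}`). [cite: YuZhao2023JointsTightened, Theorem 3.2 (§3; arXiv v2, p. 6)] -/
theorem ncard_multijoints_pow_le (hd : 2 ≤ d) (L : Fin d → Finset (Set (Fin d → F))) :
    (multijoints L).ncard ^ (d - 1) ≤ d.factorial * ∏ i, (L i).card := by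
  classical
  have hfin := multijoints_finite hd L
  have hframe : ∀ p ∈ hfin.toFinset, ∃ v : Matrix (Fin d) (Fin d) F,
      LinearIndependent F (fun i => v i) ∧ ∀ i, line F p (v i) ∈ L i := by
    intro p hp
    obtain ⟨v, hv, hL⟩ := (hfin.mem_toFinset.1 hp : IsMultijoint L p)
    exact ⟨v, hv, hL⟩
  choose! e he hL using hframe
  set cfg : JointsConfig F d := ⟨hfin.toFinset, e, fun p hp => he p hp⟩ with hcfg
  have hlines : ∀ i, cfg.linesAt i ⊆ L i := by
    intro i ℓ hℓ
    obtain ⟨p, hp, rfl⟩ := Finset.mem_image.1 hℓ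
    exact hL p hp i
  have hJ : (multijoints L).ncard = cfg.J.card := by
    rw [Set.ncard_eq_toFinset_card _ hfin]
  have h := cfg.card_le_rpow_prod_linesAt hd
  -- raise to the power `d − 1` and compare the line counts
  have hdR : (2 : ℝ) ≤ d := by exact_mod_cast hd
  have hd1' : (d - 1 : ℕ) ≠ 0 := by omega
  have hexp : ((1 : ℝ) / (d - 1)) = ((d - 1 : ℕ) : ℝ)⁻¹ := by
    rw [Nat.cast_sub (by omega), Nat.cast_one, one_div]
  have hP0 : (0 : ℝ) ≤ d.factorial * ∏ i, ((cfg.linesAt i).card : ℝ) :=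
    mul_nonneg (Nat.cast_nonneg _) (Finset.prod_nonneg fun i _ => Nat.cast_nonneg _)
  have key := pow_le_pow_left₀ (Nat.cast_nonneg _) h (d - 1)
  rw [hexp, Real.rpow_inv_natCast_pow hP0 hd1'] at key
  have hmono : (d.factorial : ℝ) * ∏ i, ((cfg.linesAt i).card : ℝ) ≤
      d.factorial * ∏ i, ((L i).card : ℝ) :=
    mul_le_mul_of_nonneg_left (Finset.prod_le_prod (fun i _ => Nat.cast_nonneg _)
      fun i _ => by exact_mod_cast Finset.card_le_card (hlines i)) (Nat.cast_nonneg _)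
  rw [hJ]
  exact_mod_cast key.trans hmono

/-- **Theorem 3.2 as printed:** `|𝓙| ≤ (d! |𝓛₁|⋯|𝓛_d|)^{1/(d−1)}` for the multijoints of
`𝓛₁, …, 𝓛_d` (`d ≥ 2`). [cite: YuZhao2023JointsTightened, Theorem 3.2 (§3; arXiv v2, p. 6)] -/
theorem ncard_multijoints_le_rpow (hd : 2 ≤ d) (L : Fin d → Finset (Set (Fin d → F))) :
    ((multijoints L).ncard : ℝ) ≤ (d.factorial * ∏ i, ((L i).card : ℝ)) ^ ((1 : ℝ) / (d - 1)) := by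
  have h := ncard_multijoints_pow_le hd L
  have h' : ((multijoints L).ncard : ℝ) ^ (d - 1) ≤ d.factorial * ∏ i, ((L i).card : ℝ) := by
    exact_mod_cast h
  have hd1' : (d - 1 : ℕ) ≠ 0 := by omega
  have key := Real.rpow_le_rpow (pow_nonneg (Nat.cast_nonneg _) _) h'
    (show (0 : ℝ) ≤ ((d - 1 : ℕ) : ℝ)⁻¹ by positivity)
  rw [Real.pow_rpow_inv_natCast (Nat.cast_nonneg _) hd1'] at key
  have hexp : ((1 : ℝ) / (d - 1)) = ((d - 1 : ℕ) : ℝ)⁻¹ := by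
    rw [Nat.cast_sub (by omega), Nat.cast_one, one_div]
  rwa [hexp]

end Multijoints

end Joints

end Literature.Combinatorics.Kakeya
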